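import Summits.FinalStateConjecture.FinalStateConjecture.Theses.DissipativeFinalMotions
import Summits.FinalStateConjecture.FinalStateConjecture.Theorems.DissipativeFinalMotionsFinalEraGenericFlatOrientation
import Summits.FinalStateConjecture.FinalStateConjecture.Theorems.DissipativeFinalMotionsFinalEraGenericTubeOrientation
import Summits.FinalStateConjecture.FinalStateConjecture.Theorems.DissipativeFinalMotionsFinalEraGenericSlabOrientation
import Summits.FinalStateConjecture.FinalStateConjecture.Theorems.DissipativeFinalMotionsDispersalFromBudget
import Summits.FinalStateConjecture.FinalStateConjecture.Theorems.DissipativeFinalMotionsFinalEraGenericRelativeCut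
import Literature.Geometry.Lorentzian.TameGenericityLocal
import HarnessLib

/-!
# Skeleton (rev 4, lead c3) — crux stmt-FinalStateConjecture-17642 `Theses.DissipativeFinalMotions.FinalEraGeneric`
# (crux, rank 4; PRE-PHASE, rev 3), line `registered` (= birth skeleton `Lines/birth.lean`, reshaped 2026-08-17 by c1, c2, c3)

REV 4 (lead c3, 2026-08-17). The rev-3 stub `stub_eraAtCensoredData` (S2b₁) is RESHAPED at the skeleton level into the two halves of
lead c2's kernel-checked Supplement B, now REGISTERED: `stub_exteriorEraAtCensoredData` (S2b₁ₐ — EXTERIOR settling is generic among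
censored data: oriented rev-2 eras WITHOUT the rays clause (R)) and `stub_raysAlongSettledCurves` (S2b₁ᵦ — INTERIOR honesty: (R) can be
secured along tame curves of exterior-settled data). S2b₁ is DERIVED (`eraAtCensoredData_of_stubs`, real proof via
`eraAtCensoredData_of_exterior_of_rays`), the crux by name is `finalEraGeneric_of_stubs` from the FOUR registered stubs S2a, S2b₁ₐ, S2b₁ᵦ,
S2b₂, and the cut stays LOSSLESS (`finalEraGeneric_iff₄`, kernel-checked here and landed sorry-free as
`Theorems/DissipativeFinalMotionsFinalEraGenericFourWayCut.lean`). Why: the two halves have different literatures and failure modes —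
S2b₁ₐ is the honest crux-sized core (black-hole exterior stability / final motions; comparable with the sibling cruxes
`SettleThenCensor.GenericSettling`, `GlobalAttraction.CensoredExteriorsSettle`), S2b₁ᵦ is black-hole INTERIOR content (no future-complete
null ray from `Σ` hides off `closure O`; cf. `SettledExteriorHoldsRays`, stmt-17673, and the closed route PocketUniverses) and is the piece
a disprover can bite. Typed notions re-verified faithful by c3 (`HasLeviCivita` is a PROVED `Prop`, `LeviCivitaProofs.hasLeviCivita`, so
the `∀ [HasLeviCivita]` binders of `HasCompleteNullInfinity` / `RaysStayInClosure` / `isRicciFlat` are not vacuous; `Spacetime` carriers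
are T2 + second countable + connected and `EmbedsInto` preserves the time-orientation CLASS only, so no rogue typed development defeats
`IsMaximal`). Everything below the rev-3 text is unchanged except the registered-stub block and the order of the composition.

CRUX (by name, not restated): for every connected Hausdorff second-countable `3`-manifold `X`, TAME-Christodoulou-generically on
`admissibleVacuumData X`, the datum has an MGHD and every MGHD has complete `𝓘⁺` and a FINAL ERA — a rev-2 package
`IsFinalEra₂ N M a T δ V C₁ C₂ ρ₀ κ ξ β U₀ B₀ B Ψ₀ Ψ O` (31 clauses, `Literature.Geometry.Lorentzian.FinalEraPackage2`) — with
(R) `RaysStayInClosure 𝒟 O`, (F) hole charts eventually future-oriented on every truncated slab `{t*ᵢ = τ, rᵢ ≤ ρ}`, and (F₀) the flat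
chart eventually future-oriented beyond a fixed flat distance from the holes.

THE CUT (principle, unchanged since birth). Tame codimension-1 genericity (`IsTameChristodoulouGeneric … 1`) is NOT closed under
conjunction of properties, so the crux does not split as "generic A ∧ generic B". It splits (i) by MONOTONICITY under pointwise
implication (`IsTameChristodoulouGeneric.mono`: pointwise upgrades of one generic core) and (ii) through the tree's DOOR for a generic
HYPOTHESIS (`Literature.Geometry.Lorentzian.InitialDataSet.isTameChristodoulouGeneric_of_relative'`, TameGenericityDiagonal.lean):
`generic P ⇐ generic Q ∧ [along every tame Q-curve whose base is P-exceptional there is a tame P-curve through the same base]`.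

RESHAPE (lead c2, rev 3). Rev 2 (lead c1) was closed modulo S1 `stub_mghdExists` (pointwise MGHD existence; waits on the unproved named
fact `choquetBruhat_geroch_exists_mghd_cauchy`) and ONE generic core S2′ `stub_tameGenericEraEffaced` (tame-generically: complete `𝓘⁺` +
era + (R) + eventual `C⁰` effacement (E)), handed back as crux-sized (`promote-stub`). Rev 3 opens S2′ through the door (ii) along the
programme's SHARED generic leaf — tame weak cosmic censorship in MGHD form, verbatim the crux `PhaseMixingCapture.WeakCosmicCensorshipTame`
(stmt-FinalStateConjecture-17269) — and registers the honest remainder as two RELATIVE stubs (censored base / naked base), stated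
LOSSLESSLY (the crux's own clause (F), not the stronger (E); base datum assumed exceptional; witness end free; conclusions LOCAL in the
parameter — only members with `0 < ‖c‖ < ε` — by `isTameChristodoulouGeneric_of_local` (TameGenericityLocal.lean); MGHD existence
carried generically, so that the pointwise S1 — and with it the named fact of Choquet-Bruhat–Geroch — drops out of this crux altogether):

* `stub_tameCensorship` (S2a, NEW, = stmt-17269 verbatim): tame-generically an MGHD exists and every MGHD has complete `𝓘⁺`.
  Shared open leaf of the summit (tame weak cosmic censorship); closes by `exact` when that item lands.
* `stub_eraAtCensoredData` (S2b₁, NEW): through every admissible CENSORED datum (with an MGHD) one of whose MGHDs lacks an oriented honest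
  era passes a tame, injective, immersed curve of admissible data all of whose other SMALL members have an MGHD and, in every MGHD,
  complete `𝓘⁺` and a rev-2 era with (R) and (F) — "settling is generic among censored data" (finitely many mergers, EIH law with `L¹` slack,
  SUB-extremal settling, honest rays: the route-specific open core, freed of censorship).
* `stub_eraNearNakedData` (S2b₂, NEW): along Christodoulou's escaping curve `F` through a NAKED admissible datum (tame, immersed,
  injective, members off `0` censored with MGHDs) there is a tame injective immersed curve through `F 0` (any end) whose SMALL members
  off `0` have MGHDs carrying oriented honest eras — "eras near naked data" (plausibly the diagonal of a parametric S2b₁ along `F`,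
  `IsTameDataFamily.comp_contDiff`).
* `stub_tubeOrientation` (S3a, PROVED p147651) and `stub_orientationSpreadsToSlabs` (S3′, PROVED p149570): kept (closed by `exact`);
  they turn eventual `C⁰` effacement (E) into (F) pointwise (`oriented_of_effaced` below), so a prover of S2b₁/S2b₂ may deliver (E).
* (F₀): the landed theorem `flatOrientation_of_isFinalEra₂` (p145731).

Composition `FinalEraGeneric_of : S2a → S2b₁ → S2b₂ → FinalEraGeneric` (real proof: locality, the door by cases on censorship of the
exceptional datum, then monotonicity adding (F₀)), `finalEraGeneric_of_stubs : FinalEraGeneric` BY NAME.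
LOSSLESSNESS (kernel-checked below, UNCONDITIONAL): `FinalEraGeneric → S2a`, `→ S2b₁`, `→ S2b₂`; hence
`finalEraGeneric_iff : FinalEraGeneric ↔ S2a ∧ S2b₁ ∧ S2b₂` — LANDED sorry-free as
`Theorems/DissipativeFinalMotionsFinalEraGenericRelativeCut.lean` (p154795: `finalEraGeneric_iff_relativeCut`,
`finalEraGeneric_of_relativeCut`, `tameCensorship_of_finalEraGeneric`, `eraAtCensoredData_of_finalEraGeneric`,
`eraNearNakedData_of_finalEraGeneric`; `finalEraGeneric_of_stubs'` below runs the registered stubs through the landed composition). The rev-2 stubs imply the rev-3 stubs (`stubs_of_effacedCore :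
S1 → S2′ → S2b₁ ∧ S2b₂`; S2a ⇐ S1 ∧ S2′ by monotonicity), so rev 3 REFINES rev 2; and lead c1's re-seam remark survives as
`finalEraGeneric_of_core_and_budget : S1 → S2 → RadiativeLyapunovBudget → FinalEraGeneric`.
Expired by this reshape: `stub_mghdExists` (S1: no longer needed — MGHD existence is generic content here; it remains the shared item
stmt-9937 of other routes; kept as the legend `Sig.stub_mghdExists`) and `stub_tameGenericEraEffaced` (S2′; legend kept).
Disproof.lean: none exists for this crux (`ledger crux ls`, 2026-08-17). Negatives index: nothing restated.
-/

set_option linter.dupNamespace false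

noncomputable section

open scoped Manifold ContDiff Topology
open Filter Set Function Literature.Geometry.Lorentzian

namespace Summit.FinalStateConjecture.FinalStateConjecture.Cruxes.FinalEraGeneric.Birth

open Summit.FinalStateConjecture.FinalStateConjecture.Theses.DissipativeFinalMotions (FinalEraGeneric
  RadiativeLyapunovBudget)
open Summit.FinalStateConjecture.FinalStateConjecture.Theorems.DissipativeFinalMotions.FinalEraGeneric
  (flatOrientation_of_isFinalEra₂)

/-! ## Legend: the stub statements as named propositions (verbatim the registered signatures) -/

/-- Statement of rev 1–2's `stub_mghdExists` (S1, retired from the skeleton by rev 3; legend for the supplement): every admissible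
datum has a maximal vacuum Cauchy development (verbatim the shared item stmt-FinalStateConjecture-9937; closable only from the
unproved named fact `choquetBruhat_geroch_exists_mghd_cauchy`). -/
def Sig.stub_mghdExists : Prop :=
  open scoped Manifold in ∀ (X : Type) [TopologicalSpace X] [ChartedSpace (EuclideanSpace ℝ (Fin 3)) X] [IsManifold (𝓡 3) ((⊤ : ℕ∞) : WithTop ℕ∞) X] [T2Space X] [SecondCountableTopology X] [ConnectedSpace X], ∀ D ∈ Literature.Geometry.Lorentzian.admissibleVacuumData X, ∃ 𝒟 : Literature.Geometry.Lorentzian.VacuumCauchyDevelopment D, 𝒟.IsMaximal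

/-- Statement of `stub_tameCensorship` (S2a): TAME weak cosmic censorship in MGHD form — verbatim the shared crux
`PhaseMixingCapture.WeakCosmicCensorshipTame` (stmt-FinalStateConjecture-17269). -/
def Sig.stub_tameCensorship : Prop :=
  open scoped Manifold in ∀ (X : Type) [TopologicalSpace X] [ChartedSpace (EuclideanSpace ℝ (Fin 3)) X] [IsManifold (𝓡 3) ((⊤ : ℕ∞) : WithTop ℕ∞) X] [T2Space X] [SecondCountableTopology X] [ConnectedSpace X], Literature.Geometry.Lorentzian.InitialDataSet.IsTameChristodoulouGeneric (Literature.Geometry.Lorentzian.admissibleVacuumData X) (fun D ↦ (∃ 𝒟 : Literature.Geometry.Lorentzian.VacuumCauchyDevelopment D, 𝒟.IsMaximal) ∧ ∀ 𝒟 : Literature.Geometry.Lorentzian.VacuumCauchyDevelopment D, 𝒟.IsMaximal → Summit.FinalStateConjecture.HasCompleteNullInfinity 𝒟.toCauchyDevelopment) 1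

/-- Statement of `stub_eraAtCensoredData` (S2b₁): through every admissible censored datum with an MGHD lacking an oriented honest
era passes a tame injective immersed curve of admissible data whose members off `0` carry oriented honest eras in every MGHD. -/
def Sig.stub_eraAtCensoredData : Prop :=
  open scoped Manifold in ∀ (X : Type) [TopologicalSpace X] [ChartedSpace (EuclideanSpace ℝ (Fin 3)) X] [IsManifold (𝓡 3) ((⊤ : ℕ∞) : WithTop ℕ∞) X] [T2Space X] [SecondCountableTopology X] [ConnectedSpace X], ∀ d ∈ Literature.Geometry.Lorentzian.admissibleVacuumData X, (∃ 𝒟 : Literature.Geometry.Lorentzian.VacuumCauchyDevelopment d, 𝒟.IsMaximal) → (∀ 𝒟 : Literature.Geometry.Lorentzian.VacuumCauchyDevelopment d, 𝒟.IsMaximal → Summit.FinalStateConjecture.HasCompleteNullInfinity 𝒟.toCauchyDevelopment) → ¬ (∀ 𝒟 : Literature.Geometry.Lorentzian.VacuumCauchyDevelopment d, 𝒟.IsMaximal → Summit.FinalStateConjecture.HasCompleteNullInfinity 𝒟.toCauchyDevelopment ∧ ∃ (N : ℕ) (M a : Fin N → ℝ) (T δ V C₁ C₂ ρ₀ κ :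 ℝ) (ξ : Fin N → ℝ → EuclideanSpace ℝ (Fin 3)) (β : ℝ → ℝ) (U₀ : TopologicalSpace.Opens Literature.Geometry.Lorentzian.E4) (B₀ : Literature.Geometry.Lorentzian.ModelBackground) (B : Fin N → Literature.Geometry.Lorentzian.ModelBackground) (Ψ₀ : B₀.domain → 𝒟.carrier) (Ψ : (i : Fin N) → (B i).domain → 𝒟.carrier) (O : Set 𝒟.carrier), 𝒟.toCauchyDevelopment.IsFinalEra₂ N M a T δ V C₁ C₂ ρ₀ κ ξ β U₀ B₀ B Ψ₀ Ψ O ∧ Summit.FinalStateConjecture.RaysStayInClosure 𝒟.toCauchyDevelopment O ∧ (∀ i (ρ : ℝ), ∀ᶠ τ in Filter.atTop, ∀ x ∈ (B i).truncTimeSlab ρ τ, 𝒟.toSpacetime.timeOrientation.IsFutureDirected (mfderiv 𝓘(ℝ, Literature.Geometry.Lorentzian.E4) (𝓡 4) (Ψ i) x (Literature.Geometry.Lorentzian.Kerr.timeVector (M i) (a i) x.1)))) → ∃ (e' : Literature.Geometry.Lorentzian.AFEnd X) (F' : EuclideanSpace ℝ (Fin 1) → Literature.Geometry.Lorentzian.InitialDataSet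 (𝓡 3) X), Literature.Geometry.Lorentzian.InitialDataSet.IsTameDataFamily e' 1 F' ∧ F' 0 = d ∧ Function.Injective F' ∧ Literature.Geometry.Lorentzian.InitialDataSet.IsImmersedAtZero 1 F' ∧ (∀ c, F' c ∈ Literature.Geometry.Lorentzian.admissibleVacuumData X) ∧ ∃ ε > (0 : ℝ), ∀ c, c ≠ 0 → ‖c‖ < ε → (∃ 𝒟 : Literature.Geometry.Lorentzian.VacuumCauchyDevelopment (F' c), 𝒟.IsMaximal) ∧ ∀ 𝒟 : Literature.Geometry.Lorentzian.VacuumCauchyDevelopment (F' c), 𝒟.IsMaximal → Summit.FinalStateConjecture.HasCompleteNullInfinity 𝒟.toCauchyDevelopment ∧ ∃ (N : ℕ) (M a : Fin N → ℝ) (T δ V C₁ C₂ ρ₀ κ : ℝ) (ξ : Fin N → ℝ → EuclideanSpace ℝ (Fin 3)) (β : ℝ → ℝ) (U₀ : TopologicalSpace.Opens Literature.Geometry.Lorentzian.E4) (B₀ : Literature.Geometry.Lorentzian.ModelBackground) (B : Fin N → Literature.Geometry.Lorentzian.ModelBackground) (Ψ₀ : B₀.domain → 𝒟.carrier) (Ψ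 : (i : Fin N) → (B i).domain → 𝒟.carrier) (O : Set 𝒟.carrier), 𝒟.toCauchyDevelopment.IsFinalEra₂ N M a T δ V C₁ C₂ ρ₀ κ ξ β U₀ B₀ B Ψ₀ Ψ O ∧ Summit.FinalStateConjecture.RaysStayInClosure 𝒟.toCauchyDevelopment O ∧ (∀ i (ρ : ℝ), ∀ᶠ τ in Filter.atTop, ∀ x ∈ (B i).truncTimeSlab ρ τ, 𝒟.toSpacetime.timeOrientation.IsFutureDirected (mfderiv 𝓘(ℝ, Literature.Geometry.Lorentzian.E4) (𝓡 4) (Ψ i) x (Literature.Geometry.Lorentzian.Kerr.timeVector (M i) (a i) x.1)))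

/-- Statement of `stub_eraNearNakedData` (S2b₂): along a tame, immersed, injective curve of admissible data through a NAKED datum
whose members off `0` are censored with MGHDs, there is a tame injective immersed curve through the same base datum (on some end)
whose members off `0` carry oriented honest eras in every MGHD. -/
def Sig.stub_eraNearNakedData : Prop :=
  open scoped Manifold in ∀ (X : Type) [TopologicalSpace X] [ChartedSpace (EuclideanSpace ℝ (Fin 3)) X] [IsManifold (𝓡 3) ((⊤ : ℕ∞) : WithTop ℕ∞) X] [T2Space X] [SecondCountableTopology X] [ConnectedSpace X] (e : Literature.Geometry.Lorentzian.AFEnd X) (F : EuclideanSpace ℝ (Fin 1) → Literature.Geometry.Lorentzian.InitialDataSet (𝓡 3) X), Literature.Geometry.Lorentzian.InitialDataSet.IsTameDataFamily e 1 F → Literature.Geometry.Lorentzian.InitialDataSet.IsImmersedAtZero 1 F → Function.Injective F → (∀ c, F c ∈ Literature.Geometry.Lorentzian.admissibleVacuumData X) → (∀ c ≠ 0, (∃ 𝒟 : Literature.Geometry.Lorentzian.VacuumCauchyDevelopment (F c), 𝒟.IsMaximal) ∧ ∀ 𝒟 : Literature.Geometry.Lorentzian.VacuumCauchyDevelopment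 (F c), 𝒟.IsMaximal → Summit.FinalStateConjecture.HasCompleteNullInfinity 𝒟.toCauchyDevelopment) → ¬ ((∃ 𝒟 : Literature.Geometry.Lorentzian.VacuumCauchyDevelopment (F 0), 𝒟.IsMaximal) ∧ ∀ 𝒟 : Literature.Geometry.Lorentzian.VacuumCauchyDevelopment (F 0), 𝒟.IsMaximal → Summit.FinalStateConjecture.HasCompleteNullInfinity 𝒟.toCauchyDevelopment) → ∃ (e' : Literature.Geometry.Lorentzian.AFEnd X) (F' : EuclideanSpace ℝ (Fin 1) → Literature.Geometry.Lorentzian.InitialDataSet (𝓡 3) X), Literature.Geometry.Lorentzian.InitialDataSet.IsTameDataFamily e' 1 F' ∧ F' 0 = F 0 ∧ Function.Injective F' ∧ Literature.Geometry.Lorentzian.InitialDataSet.IsImmersedAtZero 1 F' ∧ (∀ c, F' c ∈ Literature.Geometry.Lorentzian.admissibleVacuumData X) ∧ ∃ ε > (0 : ℝ), ∀ c, c ≠ 0 → ‖c‖ < ε → (∃ 𝒟 : Literature.Geometry.Lorentzian.VacuumCauchyDevelopment (F' c), 𝒟.IsMaximal) ∧ ∀ 𝒟 : Literature.Geometry.Lorentzian.VacuumCauchyDevelopment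 (F' c), 𝒟.IsMaximal → Summit.FinalStateConjecture.HasCompleteNullInfinity 𝒟.toCauchyDevelopment ∧ ∃ (N : ℕ) (M a : Fin N → ℝ) (T δ V C₁ C₂ ρ₀ κ : ℝ) (ξ : Fin N → ℝ → EuclideanSpace ℝ (Fin 3)) (β : ℝ → ℝ) (U₀ : TopologicalSpace.Opens Literature.Geometry.Lorentzian.E4) (B₀ : Literature.Geometry.Lorentzian.ModelBackground) (B : Fin N → Literature.Geometry.Lorentzian.ModelBackground) (Ψ₀ : B₀.domain → 𝒟.carrier) (Ψ : (i : Fin N) → (B i).domain → 𝒟.carrier) (O : Set 𝒟.carrier), 𝒟.toCauchyDevelopment.IsFinalEra₂ N M a T δ V C₁ C₂ ρ₀ κ ξ β U₀ B₀ B Ψ₀ Ψ O ∧ Summit.FinalStateConjecture.RaysStayInClosure 𝒟.toCauchyDevelopment O ∧ (∀ i (ρ : ℝ), ∀ᶠ τ in Filter.atTop, ∀ x ∈ (B i).truncTimeSlab ρ τ, 𝒟.toSpacetime.timeOrientation.IsFutureDirected (mfderiv 𝓘(ℝ, Literature.Geometry.Lorentzian.E4) (𝓡 4) (Ψ i) x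 (Literature.Geometry.Lorentzian.Kerr.timeVector (M i) (a i) x.1)))

/-- Statement of the rev-2 core `stub_tameGenericEraEffaced` (S2′, lead c1; expired by the rev-3 reshape, kept as a legend):
tame-generically, every MGHD is censored and carries a rev-2 era with (R) and eventual `C⁰` effacement at every radius (E). -/
def Sig.stub_tameGenericEraEffaced : Prop :=
  open scoped Manifold in ∀ (X : Type) [TopologicalSpace X] [ChartedSpace (EuclideanSpace ℝ (Fin 3)) X] [IsManifold (𝓡 3) ((⊤ : ℕ∞) : WithTop ℕ∞) X] [T2Space X] [SecondCountableTopology X] [ConnectedSpace X], Literature.Geometry.Lorentzian.InitialDataSet.IsTameChristodoulouGeneric (Literature.Geometry.Lorentzian.admissibleVacuumData X) (fun D ↦ ∀ 𝒟 : Literature.Geometry.Lorentzian.VacuumCauchyDevelopment D, 𝒟.IsMaximal → Summit.FinalStateConjecture.HasCompleteNullInfinity 𝒟.toCauchyDevelopment ∧ ∃ (N : ℕ) (M a : Fin N → ℝ) (T δ V C₁ C₂ ρ₀ κ : ℝ) (ξ : Fin N → ℝ → EuclideanSpace ℝ (Fin 3)) (β : ℝ → ℝ) (U₀ : TopologicalSpace.Opens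 Literature.Geometry.Lorentzian.E4) (B₀ : Literature.Geometry.Lorentzian.ModelBackground) (B : Fin N → Literature.Geometry.Lorentzian.ModelBackground) (Ψ₀ : B₀.domain → 𝒟.carrier) (Ψ : (i : Fin N) → (B i).domain → 𝒟.carrier) (O : Set 𝒟.carrier), 𝒟.toCauchyDevelopment.IsFinalEra₂ N M a T δ V C₁ C₂ ρ₀ κ ξ β U₀ B₀ B Ψ₀ Ψ O ∧ Summit.FinalStateConjecture.RaysStayInClosure 𝒟.toCauchyDevelopment O ∧ (∀ i (ρ : ℝ), ∀ᶠ τ in Filter.atTop, 𝒟.toSpacetime.truncDeviationCk (B i) (Ψ i) 0 ρ τ ≤ ENNReal.ofReal (1 / 100))) 1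

/-- Statement of the birth core `stub_tameGenericEraWithRays` (S2, expired by c1's reshape; legend): tame-generically, every MGHD
is censored and carries a rev-2 era with (R). -/
def Sig.stub_tameGenericEraWithRays : Prop :=
  open scoped Manifold in ∀ (X : Type) [TopologicalSpace X] [ChartedSpace (EuclideanSpace ℝ (Fin 3)) X] [IsManifold (𝓡 3) ((⊤ : ℕ∞) : WithTop ℕ∞) X] [T2Space X] [SecondCountableTopology X] [ConnectedSpace X], Literature.Geometry.Lorentzian.InitialDataSet.IsTameChristodoulouGeneric (Literature.Geometry.Lorentzian.admissibleVacuumData X) (fun D ↦ ∀ 𝒟 : Literature.Geometry.Lorentzian.VacuumCauchyDevelopment D, 𝒟.IsMaximal → Summit.FinalStateConjecture.HasCompleteNullInfinity 𝒟.toCauchyDevelopment ∧ ∃ (N : ℕ) (M a : Fin N → ℝ) (T δ V C₁ C₂ ρ₀ κ : ℝ) (ξ : Fin N → ℝ → EuclideanSpace ℝ (Fin 3)) (β : ℝ → ℝ) (U₀ : TopologicalSpace.Opens Literature.Geometry.Lorentzian.E4) (B₀ : Literature.Geometry.Lorentzian.ModelBackground) (B : Fin N → Literature.Geometry.Lorentzian.ModelBackground)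 (Ψ₀ : B₀.domain → 𝒟.carrier) (Ψ : (i : Fin N) → (B i).domain → 𝒟.carrier) (O : Set 𝒟.carrier), 𝒟.toCauchyDevelopment.IsFinalEra₂ N M a T δ V C₁ C₂ ρ₀ κ ξ β U₀ B₀ B Ψ₀ Ψ O ∧ Summit.FinalStateConjecture.RaysStayInClosure 𝒟.toCauchyDevelopment O) 1

/-- Statement of `stub_tubeOrientation` (S3a): the hole charts of any rev-2 era are future-oriented on the certified tubes. -/
def Sig.stub_tubeOrientation : Prop :=
  open scoped Manifold in ∀ (X : Type) [TopologicalSpace X] [ChartedSpace (EuclideanSpace ℝ (Fin 3)) X] [IsManifold (𝓡 3) ((⊤ : ℕ∞) : WithTop ℕ∞) X] [T2Space X] [SecondCountableTopology X] [ConnectedSpace X], ∀ D ∈ Literature.Geometry.Lorentzian.admissibleVacuumData X, ∀ 𝒟 : Literature.Geometry.Lorentzian.VacuumCauchyDevelopment D, 𝒟.IsMaximal → Summit.FinalStateConjecture.HasCompleteNullInfinity 𝒟.toCauchyDevelopment → ∀ (N : ℕ) (M a : Fin N → ℝ) (T δ V C₁ C₂ ρ₀ κ : ℝ) (ξ : Fin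 N → ℝ → EuclideanSpace ℝ (Fin 3)) (β : ℝ → ℝ) (U₀ : TopologicalSpace.Opens Literature.Geometry.Lorentzian.E4) (B₀ : Literature.Geometry.Lorentzian.ModelBackground) (B : Fin N → Literature.Geometry.Lorentzian.ModelBackground) (Ψ₀ : B₀.domain → 𝒟.carrier) (Ψ : (i : Fin N) → (B i).domain → 𝒟.carrier) (O : Set 𝒟.carrier), 𝒟.toCauchyDevelopment.IsFinalEra₂ N M a T δ V C₁ C₂ ρ₀ κ ξ β U₀ B₀ B Ψ₀ Ψ O → (∀ i (τ : ℝ), T < τ → ∀ x ∈ (B i).truncTimeSlab (2 * ρ₀) τ, 𝒟.toSpacetime.timeOrientation.IsFutureDirected (mfderiv 𝓘(ℝ, Literature.Geometry.Lorentzian.E4) (𝓡 4) (Ψ i) x (Literature.Geometry.Lorentzian.Kerr.timeVector (M i) (a i) x.1)))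

/-- Statement of `stub_orientationSpreadsToSlabs` (S3′): tube orientation spreads to every `C⁰`-pinned slab. -/
def Sig.stub_orientationSpreadsToSlabs : Prop :=
  open scoped Manifold in ∀ (X : Type) [TopologicalSpace X] [ChartedSpace (EuclideanSpace ℝ (Fin 3)) X] [IsManifold (𝓡 3) ((⊤ : ℕ∞) : WithTop ℕ∞) X] [T2Space X] [SecondCountableTopology X] [ConnectedSpace X], ∀ D ∈ Literature.Geometry.Lorentzian.admissibleVacuumData X, ∀ 𝒟 : Literature.Geometry.Lorentzian.VacuumCauchyDevelopment D, 𝒟.IsMaximal → Summit.FinalStateConjecture.HasCompleteNullInfinity 𝒟.toCauchyDevelopment → ∀ (N : ℕ) (M a : Fin N → ℝ) (T δ V C₁ C₂ ρ₀ κ : ℝ) (ξ : Fin N → ℝ → EuclideanSpace ℝ (Fin 3)) (β : ℝ → ℝ) (U₀ : TopologicalSpace.Opens Literature.Geometry.Lorentzian.E4) (B₀ : Literature.Geometry.Lorentzian.ModelBackground) (B : Fin N → Literature.Geometry.Lorentzian.ModelBackground) (Ψ₀ : B₀.domain → 𝒟.carrier) (Ψ : (i : Fin N) → (B i).domain → 𝒟.carrier)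 (O : Set 𝒟.carrier), 𝒟.toCauchyDevelopment.IsFinalEra₂ N M a T δ V C₁ C₂ ρ₀ κ ξ β U₀ B₀ B Ψ₀ Ψ O → (∀ i (τ : ℝ), T < τ → ∀ x ∈ (B i).truncTimeSlab (2 * ρ₀) τ, 𝒟.toSpacetime.timeOrientation.IsFutureDirected (mfderiv 𝓘(ℝ, Literature.Geometry.Lorentzian.E4) (𝓡 4) (Ψ i) x (Literature.Geometry.Lorentzian.Kerr.timeVector (M i) (a i) x.1))) → ∀ i (ρ τ : ℝ), T < τ → 𝒟.toSpacetime.truncDeviationCk (B i) (Ψ i) 0 ρ τ ≤ ENNReal.ofReal (1 / 100) → ∀ x ∈ (B i).truncTimeSlab ρ τ, 𝒟.toSpacetime.timeOrientation.IsFutureDirected (mfderiv 𝓘(ℝ, Literature.Geometry.Lorentzian.E4) (𝓡 4) (Ψ i) x (Literature.Geometry.Lorentzian.Kerr.timeVector (M i) (a i) x.1))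

/-! ## Registered stubs (`sorry` only here; signatures def-free and self-contained) -/

/-- **S2a — TAME WEAK COSMIC CENSORSHIP IN MGHD FORM (the summit's shared generic leaf; verbatim the crux
`PhaseMixingCapture.WeakCosmicCensorshipTame`, stmt-FinalStateConjecture-17269).** For every connected Hausdorff
second-countable `3`-manifold `X`, tame-Christodoulou-generically on `admissibleVacuumData X` (escaping one-parameter family on
ONE fixed asymptotically flat end, jointly smooth, `wDist`-continuous at `c = 0`, injective, immersed at `0`), a maximal vacuum
Cauchy development exists and EVERY MGHD has complete future null infinity (sojourn form, `HasCompleteNullInfinity`). This is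
the generic HYPOTHESIS through which the era statement becomes generic (door lemma `isTameChristodoulouGeneric_of_relative'`): it
is NECESSARY (`censorship_of_finalEraGeneric`: the crux implies it by `IsTameChristodoulouGeneric.mono`) and it is the first
conjunct-structure of the re-typed summit. It closes by `exact` when stmt-17269 (or any of its verbatim copies) lands. Why it
might fail: it is weak cosmic censorship for one-ended asymptotically flat vacuum data, open outside symmetry; vacuum naked
singularities exist non-generically (Rodnianski–Shlapentokh-Rothman 2019), and TAME codimension 1 needs escaping families on
the datum's own end with continuous ADM mass (burial/rescaling witnesses are excluded). Size: open-problem. Sources: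
Christodoulou1999 (CQG 16, p. A24), Christodoulou Ann. Math. 149 (1999), arXiv:1912.08478, arXiv:0811.0354 §2.6.2,
DafermosLuk2017, KehleUnger2025. -/
theorem stub_tameCensorship : open scoped Manifold in ∀ (X : Type) [TopologicalSpace X] [ChartedSpace (EuclideanSpace ℝ (Fin 3)) X] [IsManifold (𝓡 3) ((⊤ : ℕ∞) : WithTop ℕ∞) X] [T2Space X] [SecondCountableTopology X] [ConnectedSpace X], Literature.Geometry.Lorentzian.InitialDataSet.IsTameChristodoulouGeneric (Literature.Geometry.Lorentzian.admissibleVacuumData X) (fun D ↦ (∃ 𝒟 : Literature.Geometry.Lorentzian.VacuumCauchyDevelopment D, 𝒟.IsMaximal) ∧ ∀ 𝒟 : Literature.Geometry.Lorentzian.VacuumCauchyDevelopment D, 𝒟.IsMaximal → Summit.FinalStateConjecture.HasCompleteNullInfinity 𝒟.toCauchyDevelopment) 1 := by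
  sorry

/-- **S2b₁ₐ — EXTERIOR SETTLING IS GENERIC AMONG CENSORED DATA (relative core, censored base; registered by rev 4 in place of
S2b₁; the route-specific open content freed of censorship AND of the rays clause).** Let `d` be an admissible datum which has an
MGHD, all of whose MGHDs have complete `𝓘⁺` (censored), but one of whose MGHDs carries NO oriented rev-2 era (no package
`IsFinalEra₂ …` with (F) eventual future-orientation of every hole chart on every truncated slab — the rays clause (R) is NOT asked).
Then through `d` passes a one-parameter family `F'` of admissible data, tame on some asymptotically flat end `e'` of `X`, injective,
immersed at `0`, `F' 0 = d`, all of whose SMALL members (`0 < ‖c‖ < ε`, some `ε > 0`; avoidance is local in the parameter,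
`exists_tameCurve_of_local`) have an MGHD, and every MGHD censored AND carrying an oriented rev-2 era (without (R)).
Informally: among censored developments, failure of the EXTERIOR to settle into finitely many SUB-extremal Kerr holes on
near-Newtonian worldlines (δ-floor, `V`-Lipschitz, EIH law with 1PN slack `κ` and `L¹` slack `β`, certified tubes, effacement, flat
far chart) with future-oriented charts (F) is a tame codimension-≥1 phenomenon — finitely many mergers, no eternal tight clusters, the
third law generically (extremal settling is codimension ≥ 1, Kehle–Unger). NECESSARY (`exteriorEraAtCensored_of_finalEraGeneric`:
the crux implies it, kernel-checked; landed in `Theorems/DissipativeFinalMotionsFinalEraGenericFourWayCut.lean`). With S2b₁ᵦ it gives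
back rev 3's S2b₁ (`eraAtCensoredData_of_exterior_of_rays`). A prover may deliver eventual `C⁰` effacement (E) instead of (F)
(`oriented_of_effaced`). Comparable sibling cruxes (other routes, NOT identical: they speak `FinalStateDecomposition`, not the rev-2
package): `SettleThenCensor.GenericSettling` (stmt-17274), `GlobalAttraction.CensoredExteriorsSettle`. Anti-vacuity: censored data exist
(trivial data; `minkowski_hasCompleteNullInfinity`), and the conclusion's property is satisfiable at `N = 0`
(`BartnikGapSettling.Capture.stub_minkowskiEra`). Why it might fail: tame-generic parking at extremality or infinite merger cascades
among censored data; an exterior-era-exceptional set accumulating at `d` from every tame direction; for `N ≥ 2` the single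
Kerr–Schild exterior chart per hole must be radially compressed far out (refuter VETTING.md §4) — legal, but every clause must then be
met by such charts. Size: open-problem (the final-state pre-phase given censorship, exterior part). Sources: DafermosLuk2017 (p. 8,
Conj. 1), KehleUnger2025, EinsteinInfeldHoffmann1938, Blanchet2024, Hintz2024GluingIII, GiorgiKlainermanSzeftel2022, arXiv:2104.08222,
arXiv:0811.0354. -/
theorem stub_exteriorEraAtCensoredData : open scoped Manifold in ∀ (X : Type) [TopologicalSpace X] [ChartedSpace (EuclideanSpace ℝ (Fin 3)) X] [IsManifold (𝓡 3) ((⊤ : ℕ∞) : WithTop ℕ∞) X] [T2Space X] [SecondCountableTopology X] [ConnectedSpace X], ∀ d ∈ Literature.Geometry.Lorentzian.admissibleVacuumData X, (∃ 𝒟 : Literature.Geometry.Lorentzian.VacuumCauchyDevelopment d, 𝒟.IsMaximal) → (∀ 𝒟 : Literature.Geometry.Lorentzian.VacuumCauchyDevelopment d, 𝒟.IsMaximal → Summit.FinalStateConjecture.HasCompleteNullInfinity 𝒟.toCauchyDevelopment) → ¬ (∀ 𝒟 : Literature.Geometry.Lorentzian.VacuumCauchyDevelopment d, 𝒟.IsMaximal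 → Summit.FinalStateConjecture.HasCompleteNullInfinity 𝒟.toCauchyDevelopment ∧ ∃ (N : ℕ) (M a : Fin N → ℝ) (T δ V C₁ C₂ ρ₀ κ : ℝ) (ξ : Fin N → ℝ → EuclideanSpace ℝ (Fin 3)) (β : ℝ → ℝ) (U₀ : TopologicalSpace.Opens Literature.Geometry.Lorentzian.E4) (B₀ : Literature.Geometry.Lorentzian.ModelBackground) (B : Fin N → Literature.Geometry.Lorentzian.ModelBackground) (Ψ₀ : B₀.domain → 𝒟.carrier) (Ψ : (i : Fin N) → (B i).domain → 𝒟.carrier) (O : Set 𝒟.carrier), 𝒟.toCauchyDevelopment.IsFinalEra₂ N M a T δ V C₁ C₂ ρ₀ κ ξ β U₀ B₀ B Ψ₀ Ψ O ∧ (∀ i (ρ : ℝ), ∀ᶠ τ in Filter.atTop, ∀ x ∈ (B i).truncTimeSlab ρ τ, 𝒟.toSpacetime.timeOrientation.IsFutureDirected (mfderiv 𝓘(ℝ, Literature.Geometry.Lorentzian.E4) (𝓡 4) (Ψ i) x (Literature.Geometry.Lorentzian.Kerr.timeVector (M i) (a i) x.1)))) → ∃ (e' : Literature.Geometry.Lorentzian.AFEnd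 X) (F' : EuclideanSpace ℝ (Fin 1) → Literature.Geometry.Lorentzian.InitialDataSet (𝓡 3) X), Literature.Geometry.Lorentzian.InitialDataSet.IsTameDataFamily e' 1 F' ∧ F' 0 = d ∧ Function.Injective F' ∧ Literature.Geometry.Lorentzian.InitialDataSet.IsImmersedAtZero 1 F' ∧ (∀ c, F' c ∈ Literature.Geometry.Lorentzian.admissibleVacuumData X) ∧ ∃ ε > (0 : ℝ), ∀ c, c ≠ 0 → ‖c‖ < ε → (∃ 𝒟 : Literature.Geometry.Lorentzian.VacuumCauchyDevelopment (F' c), 𝒟.IsMaximal) ∧ ∀ 𝒟 : Literature.Geometry.Lorentzian.VacuumCauchyDevelopment (F' c), 𝒟.IsMaximal → Summit.FinalStateConjecture.HasCompleteNullInfinity 𝒟.toCauchyDevelopment ∧ ∃ (N : ℕ) (M a : Fin N → ℝ) (T δ V C₁ C₂ ρ₀ κ : ℝ) (ξ : Fin N → ℝ → EuclideanSpace ℝ (Fin 3)) (β : ℝ → ℝ) (U₀ : TopologicalSpace.Opens Literature.Geometry.Lorentzian.E4) (B₀ : Literature.Geometry.Lorentzian.ModelBackground) (B : Fin N → Literature.Geometry.Lorentzian.ModelBackground)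 (Ψ₀ : B₀.domain → 𝒟.carrier) (Ψ : (i : Fin N) → (B i).domain → 𝒟.carrier) (O : Set 𝒟.carrier), 𝒟.toCauchyDevelopment.IsFinalEra₂ N M a T δ V C₁ C₂ ρ₀ κ ξ β U₀ B₀ B Ψ₀ Ψ O ∧ (∀ i (ρ : ℝ), ∀ᶠ τ in Filter.atTop, ∀ x ∈ (B i).truncTimeSlab ρ τ, 𝒟.toSpacetime.timeOrientation.IsFutureDirected (mfderiv 𝓘(ℝ, Literature.Geometry.Lorentzian.E4) (𝓡 4) (Ψ i) x (Literature.Geometry.Lorentzian.Kerr.timeVector (M i) (a i) x.1))) := by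
  sorry

/-- **S2b₁ᵦ — HONEST RAYS ALONG SETTLED CURVES (relative, registered by rev 4 in place of S2b₁; the INTERIOR content of the crux).**
Let `F` be a one-parameter family of admissible data, tame on the end `e`, which is EITHER injective and immersed at `0` OR constant,
all of whose members off `0` have an MGHD and, in every MGHD, complete `𝓘⁺` and an oriented rev-2 era WITHOUT the rays clause
(exterior-settled), and whose base `F 0` has an MGHD, is censored, but has an MGHD without an oriented HONEST era (rev-2 package + (R)
`RaysStayInClosure` + (F)). Then through `F 0` passes a one-parameter family `F'` of admissible data, tame on some end `e'`, injective,
immersed at `0`, `F' 0 = F 0`, all of whose SMALL members (`0 < ‖c‖ < ε`) have an MGHD and, in every MGHD, complete `𝓘⁺` and an oriented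
HONEST era (with (R)). The constant-curve case is the datum whose exteriors already settle in every MGHD but where some MGHD hides a
future-complete normalised null ray from `Σ` off `closure O` for every era: such data must be tame-codimension ≥ 1, escapable towards
honestly settled data. Informally: generically along settled curves no future-complete null ray from `Σ` hides behind the horizons
(inside a sub-extremal Kerr-like black hole every causal geodesic leaving the exterior reaches the Cauchy horizon / MGHD boundary at
finite affinity — Dafermos–Luk `C⁰`-stability of the Kerr Cauchy horizon — so complete rays are exterior or horizon generators, which lie
in `closure O`). NECESSARY (`raysAlongSettledCurves_of_finalEraGeneric`, kernel-checked, landed in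
`Theorems/DissipativeFinalMotionsFinalEraGenericFourWayCut.lean`); with S2b₁ₐ it gives back S2b₁. Related pointwise item:
`RaychaudhuriBlowdown.SettledExteriorHoldsRays` (stmt-17673); the pocket-universe refutation of the typed (R) is closed programme-wide
(tendril decompositions; route PocketUniverses). Why it might fail: a tame-codimension-0 family of censored, exterior-settled data whose
MGHDs contain a future-complete null ray from `Σ` entering a black hole and never returning to `closure O` (a stably "regular" interior
end, e.g. an expanding interior region) — this would refute the crux itself, not only this stub. Size: open-problem (black-hole interior,
generic structure of the MGHD boundary). Sources: DafermosLuk2017 (Thm. 1, p. 8), arXiv:1710.01722, Penrose1982, arXiv:0811.0354 §2.6.2,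
Christodoulou1999 (pp. A26–A27), KehleUnger2024. -/
theorem stub_raysAlongSettledCurves : open scoped Manifold in ∀ (X : Type) [TopologicalSpace X] [ChartedSpace (EuclideanSpace ℝ (Fin 3)) X] [IsManifold (𝓡 3) ((⊤ : ℕ∞) : WithTop ℕ∞) X] [T2Space X] [SecondCountableTopology X] [ConnectedSpace X] (e : Literature.Geometry.Lorentzian.AFEnd X) (F : EuclideanSpace ℝ (Fin 1) → Literature.Geometry.Lorentzian.InitialDataSet (𝓡 3) X), Literature.Geometry.Lorentzian.InitialDataSet.IsTameDataFamily e 1 F → ((Literature.Geometry.Lorentzian.InitialDataSet.IsImmersedAtZero 1 F ∧ Function.Injective F) ∨ ∀ c, F c = F 0) → (∀ c, F c ∈ Literature.Geometry.Lorentzian.admissibleVacuumData X) → (∀ c ≠ 0, (∃ 𝒟 : Literature.Geometry.Lorentzian.VacuumCauchyDevelopment (F c), 𝒟.IsMaximal) ∧ ∀ 𝒟 : Literature.Geometry.Lorentzian.VacuumCauchyDevelopment (F c), 𝒟.IsMaximal → Summit.FinalStateConjecture.HasCompleteNullInfinity 𝒟.toCauchyDevelopment ∧ ∃ (N : ℕ)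 (M a : Fin N → ℝ) (T δ V C₁ C₂ ρ₀ κ : ℝ) (ξ : Fin N → ℝ → EuclideanSpace ℝ (Fin 3)) (β : ℝ → ℝ) (U₀ : TopologicalSpace.Opens Literature.Geometry.Lorentzian.E4) (B₀ : Literature.Geometry.Lorentzian.ModelBackground) (B : Fin N → Literature.Geometry.Lorentzian.ModelBackground) (Ψ₀ : B₀.domain → 𝒟.carrier) (Ψ : (i : Fin N) → (B i).domain → 𝒟.carrier) (O : Set 𝒟.carrier), 𝒟.toCauchyDevelopment.IsFinalEra₂ N M a T δ V C₁ C₂ ρ₀ κ ξ β U₀ B₀ B Ψ₀ Ψ O ∧ (∀ i (ρ : ℝ), ∀ᶠ τ in Filter.atTop, ∀ x ∈ (B i).truncTimeSlab ρ τ, 𝒟.toSpacetime.timeOrientation.IsFutureDirected (mfderiv 𝓘(ℝ, Literature.Geometry.Lorentzian.E4) (𝓡 4) (Ψ i) x (Literature.Geometry.Lorentzian.Kerr.timeVector (M i) (a i) x.1)))) → (∃ 𝒟 : Literature.Geometry.Lorentzian.VacuumCauchyDevelopment (F 0), 𝒟.IsMaximal) → (∀ 𝒟 : Literature.Geometry.Lorentzian.VacuumCauchyDevelopment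 (F 0), 𝒟.IsMaximal → Summit.FinalStateConjecture.HasCompleteNullInfinity 𝒟.toCauchyDevelopment) → ¬ (∀ 𝒟 : Literature.Geometry.Lorentzian.VacuumCauchyDevelopment (F 0), 𝒟.IsMaximal → Summit.FinalStateConjecture.HasCompleteNullInfinity 𝒟.toCauchyDevelopment ∧ ∃ (N : ℕ) (M a : Fin N → ℝ) (T δ V C₁ C₂ ρ₀ κ : ℝ) (ξ : Fin N → ℝ → EuclideanSpace ℝ (Fin 3)) (β : ℝ → ℝ) (U₀ : TopologicalSpace.Opens Literature.Geometry.Lorentzian.E4) (B₀ : Literature.Geometry.Lorentzian.ModelBackground) (B : Fin N → Literature.Geometry.Lorentzian.ModelBackground) (Ψ₀ : B₀.domain → 𝒟.carrier) (Ψ : (i : Fin N) → (B i).domain → 𝒟.carrier) (O : Set 𝒟.carrier), 𝒟.toCauchyDevelopment.IsFinalEra₂ N M a T δ V C₁ C₂ ρ₀ κ ξ β U₀ B₀ B Ψ₀ Ψ O ∧ Summit.FinalStateConjecture.RaysStayInClosure 𝒟.toCauchyDevelopment O ∧ (∀ i (ρ : ℝ), ∀ᶠ τ in Filter.atTop, ∀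 x ∈ (B i).truncTimeSlab ρ τ, 𝒟.toSpacetime.timeOrientation.IsFutureDirected (mfderiv 𝓘(ℝ, Literature.Geometry.Lorentzian.E4) (𝓡 4) (Ψ i) x (Literature.Geometry.Lorentzian.Kerr.timeVector (M i) (a i) x.1)))) → ∃ (e' : Literature.Geometry.Lorentzian.AFEnd X) (F' : EuclideanSpace ℝ (Fin 1) → Literature.Geometry.Lorentzian.InitialDataSet (𝓡 3) X), Literature.Geometry.Lorentzian.InitialDataSet.IsTameDataFamily e' 1 F' ∧ F' 0 = F 0 ∧ Function.Injective F' ∧ Literature.Geometry.Lorentzian.InitialDataSet.IsImmersedAtZero 1 F' ∧ (∀ c, F' c ∈ Literature.Geometry.Lorentzian.admissibleVacuumData X) ∧ ∃ ε > (0 : ℝ), ∀ c, c ≠ 0 → ‖c‖ < ε → (∃ 𝒟 : Literature.Geometry.Lorentzian.VacuumCauchyDevelopment (F' c), 𝒟.IsMaximal) ∧ ∀ 𝒟 : Literature.Geometry.Lorentzian.VacuumCauchyDevelopment (F' c), 𝒟.IsMaximal → Summit.FinalStateConjecture.HasCompleteNullInfinity 𝒟.toCauchyDevelopment ∧ ∃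 (N : ℕ) (M a : Fin N → ℝ) (T δ V C₁ C₂ ρ₀ κ : ℝ) (ξ : Fin N → ℝ → EuclideanSpace ℝ (Fin 3)) (β : ℝ → ℝ) (U₀ : TopologicalSpace.Opens Literature.Geometry.Lorentzian.E4) (B₀ : Literature.Geometry.Lorentzian.ModelBackground) (B : Fin N → Literature.Geometry.Lorentzian.ModelBackground) (Ψ₀ : B₀.domain → 𝒟.carrier) (Ψ : (i : Fin N) → (B i).domain → 𝒟.carrier) (O : Set 𝒟.carrier), 𝒟.toCauchyDevelopment.IsFinalEra₂ N M a T δ V C₁ C₂ ρ₀ κ ξ β U₀ B₀ B Ψ₀ Ψ O ∧ Summit.FinalStateConjecture.RaysStayInClosure 𝒟.toCauchyDevelopment O ∧ (∀ i (ρ : ℝ), ∀ᶠ τ in Filter.atTop, ∀ x ∈ (B i).truncTimeSlab ρ τ, 𝒟.toSpacetime.timeOrientation.IsFutureDirected (mfderiv 𝓘(ℝ, Literature.Geometry.Lorentzian.E4) (𝓡 4) (Ψ i) x (Literature.Geometry.Lorentzian.Kerr.timeVector (M i) (a i) x.1))) := by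
  sorry

/-- **S2b₂ — ERAS NEAR NAKED DATA (relative core, naked base).** Let `F` be Christodoulou's escaping curve through a NAKED
admissible datum: a one-parameter family of admissible data, tame on the end `e`, immersed at `0`, injective, whose base `F 0` is
NOT censored-with-MGHD (some MGHD has incomplete `𝓘⁺` — or no MGHD exists, a case the named fact of Choquet-Bruhat–Geroch
excludes) while every member off `0` has an MGHD and all its MGHDs censored. Then through `F 0` passes a one-parameter family `F'`
of admissible data, tame on SOME end `e'`, injective, immersed at `0`, `F' 0 = F 0`, all of whose SMALL members (`0 < ‖c‖ < ε`,
some `ε > 0`; local form, `exists_tameCurve_of_local`) have an MGHD and every MGHD censored and carrying an oriented honest era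
(rev-2 package + (R) + (F)).
Informally: next to naked-singularity formation (Christodoulou's examples; Rodnianski–Shlapentokh-Rothman in vacuum) the censored
perturbations along the escaping curve — tiny black holes or dispersal — themselves settle with honest eras, at least along SOME
tame curve through the naked datum; plausibly the diagonal `c ↦ G (c, c)` of a parametric version of S2b₁ along `F`
(`IsTameDataFamily.comp_contDiff`), or `F' = F` itself when the members of the escaping curve settle. NECESSARY
(`eraNearNaked_of_finalEraGeneric`; the end is left free because the crux's own witness may live on another end,
cf. `isTameChristodoulouGeneric_of_relative'`). Why it might fail: eras of the censored members of `F` degenerate as `c → 0`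
(parameters `T(c) → ∞`, `δ(c) → 0` are allowed — the era is per member — but tameness of a re-chosen curve `F'` on one end with
continuous mass is a real constraint); no theorem controls the global future of data near a vacuum naked singularity.
Size: open-problem. Sources: Christodoulou1999, Christodoulou Ann. Math. 149 (1999) p. 187, arXiv:1912.08478, DafermosLuk2017,
KehleUnger2025, arXiv:0811.0354. -/
theorem stub_eraNearNakedData : open scoped Manifold in ∀ (X : Type) [TopologicalSpace X] [ChartedSpace (EuclideanSpace ℝ (Fin 3)) X] [IsManifold (𝓡 3) ((⊤ : ℕ∞) : WithTop ℕ∞) X] [T2Space X] [SecondCountableTopology X] [ConnectedSpace X] (e : Literature.Geometry.Lorentzian.AFEnd X) (F : EuclideanSpace ℝ (Fin 1) → Literature.Geometry.Lorentzian.InitialDataSet (𝓡 3) X), Literature.Geometry.Lorentzian.InitialDataSet.IsTameDataFamily e 1 F → Literature.Geometry.Lorentzian.InitialDataSet.IsImmersedAtZero 1 F → Function.Injective F → (∀ c, F c ∈ Literature.Geometry.Lorentzian.admissibleVacuumData X) → (∀ c ≠ 0, (∃ 𝒟 : Literature.Geometry.Lorentzian.VacuumCauchyDevelopment (F c), 𝒟.IsMaximal)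 ∧ ∀ 𝒟 : Literature.Geometry.Lorentzian.VacuumCauchyDevelopment (F c), 𝒟.IsMaximal → Summit.FinalStateConjecture.HasCompleteNullInfinity 𝒟.toCauchyDevelopment) → ¬ ((∃ 𝒟 : Literature.Geometry.Lorentzian.VacuumCauchyDevelopment (F 0), 𝒟.IsMaximal) ∧ ∀ 𝒟 : Literature.Geometry.Lorentzian.VacuumCauchyDevelopment (F 0), 𝒟.IsMaximal → Summit.FinalStateConjecture.HasCompleteNullInfinity 𝒟.toCauchyDevelopment) → ∃ (e' : Literature.Geometry.Lorentzian.AFEnd X) (F' : EuclideanSpace ℝ (Fin 1) → Literature.Geometry.Lorentzian.InitialDataSet (𝓡 3) X), Literature.Geometry.Lorentzian.InitialDataSet.IsTameDataFamily e' 1 F' ∧ F' 0 = F 0 ∧ Function.Injective F' ∧ Literature.Geometry.Lorentzian.InitialDataSet.IsImmersedAtZero 1 F' ∧ (∀ c, F' c ∈ Literature.Geometry.Lorentzian.admissibleVacuumData X) ∧ ∃ ε > (0 : ℝ), ∀ c, c ≠ 0 → ‖c‖ < ε → (∃ 𝒟 : Literature.Geometry.Lorentzian.VacuumCauchyDevelopment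 (F' c), 𝒟.IsMaximal) ∧ ∀ 𝒟 : Literature.Geometry.Lorentzian.VacuumCauchyDevelopment (F' c), 𝒟.IsMaximal → Summit.FinalStateConjecture.HasCompleteNullInfinity 𝒟.toCauchyDevelopment ∧ ∃ (N : ℕ) (M a : Fin N → ℝ) (T δ V C₁ C₂ ρ₀ κ : ℝ) (ξ : Fin N → ℝ → EuclideanSpace ℝ (Fin 3)) (β : ℝ → ℝ) (U₀ : TopologicalSpace.Opens Literature.Geometry.Lorentzian.E4) (B₀ : Literature.Geometry.Lorentzian.ModelBackground) (B : Fin N → Literature.Geometry.Lorentzian.ModelBackground) (Ψ₀ : B₀.domain → 𝒟.carrier) (Ψ : (i : Fin N) → (B i).domain → 𝒟.carrier) (O : Set 𝒟.carrier), 𝒟.toCauchyDevelopment.IsFinalEra₂ N M a T δ V C₁ C₂ ρ₀ κ ξ β U₀ B₀ B Ψ₀ Ψ O ∧ Summit.FinalStateConjecture.RaysStayInClosure 𝒟.toCauchyDevelopment O ∧ (∀ i (ρ : ℝ), ∀ᶠ τ in Filter.atTop, ∀ x ∈ (B i).truncTimeSlab ρ τ, 𝒟.toSpacetime.timeOrientation.IsFutureDirected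 (mfderiv 𝓘(ℝ, Literature.Geometry.Lorentzian.E4) (𝓡 4) (Ψ i) x (Literature.Geometry.Lorentzian.Kerr.timeVector (M i) (a i) x.1))) := by
  sorry

/-- **S3a — HOLE CHARTS OF AN ERA ARE FUTURE-ORIENTED ON THEIR CERTIFIED TUBES (pointwise; PROVED and LANDED, p147651,
`Theorems/DissipativeFinalMotionsFinalEraGenericTubeOrientation.lean`, closed by `exact`).** For an admissible datum, a maximal
development with complete `𝓘⁺` and ANY rev-2 era package: for every hole `i`, chart time `τ > T` and point `x` of the truncated
Kerr–Schild slab `{t*ᵢ = τ, rᵢ ≤ 2ρ₀}`, the push-forward `dΨᵢ(V_{Mᵢ,aᵢ})` is future-directed causal. Sources: ONeill1983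
(Ch. 5, Ch. 14), arXiv:0811.0354 §5.1, arXiv:0706.0622. -/
theorem stub_tubeOrientation : open scoped Manifold in ∀ (X : Type) [TopologicalSpace X] [ChartedSpace (EuclideanSpace ℝ (Fin 3)) X] [IsManifold (𝓡 3) ((⊤ : ℕ∞) : WithTop ℕ∞) X] [T2Space X] [SecondCountableTopology X] [ConnectedSpace X], ∀ D ∈ Literature.Geometry.Lorentzian.admissibleVacuumData X, ∀ 𝒟 : Literature.Geometry.Lorentzian.VacuumCauchyDevelopment D, 𝒟.IsMaximal → Summit.FinalStateConjecture.HasCompleteNullInfinity 𝒟.toCauchyDevelopment → ∀ (N : ℕ) (M a : Fin N → ℝ) (T δ V C₁ C₂ ρ₀ κ : ℝ) (ξ : Fin N → ℝ → EuclideanSpace ℝ (Fin 3)) (β : ℝ → ℝ) (U₀ : TopologicalSpace.Opens Literature.Geometry.Lorentzian.E4) (B₀ : Literature.Geometry.Lorentzian.ModelBackground) (B : Fin N → Literature.Geometry.Lorentzian.ModelBackground) (Ψ₀ : B₀.domain → 𝒟.carrier) (Ψ : (i : Fin N) → (B i).domain → 𝒟.carrier) (O : Set 𝒟.carrier), 𝒟.toCauchyDevelopment.IsFinalEra₂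 N M a T δ V C₁ C₂ ρ₀ κ ξ β U₀ B₀ B Ψ₀ Ψ O → (∀ i (τ : ℝ), T < τ → ∀ x ∈ (B i).truncTimeSlab (2 * ρ₀) τ, 𝒟.toSpacetime.timeOrientation.IsFutureDirected (mfderiv 𝓘(ℝ, Literature.Geometry.Lorentzian.E4) (𝓡 4) (Ψ i) x (Literature.Geometry.Lorentzian.Kerr.timeVector (M i) (a i) x.1))) :=
  Summit.FinalStateConjecture.FinalStateConjecture.Theorems.DissipativeFinalMotions.FinalEraGeneric.stub_tubeOrientation

/-- **S3′ — TUBE ORIENTATION SPREADS TO EVERY `C⁰`-PINNED SLAB (pointwise; PROVED and LANDED, p149570,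
`Theorems/DissipativeFinalMotionsFinalEraGenericSlabOrientation.lean`, closed by `exact`).** For an admissible datum, a maximal
development with complete `𝓘⁺`, a rev-2 era package future-oriented on the certified tubes, a hole `i`, a radius `ρ` and a chart
time `τ > T` with `truncDeviationCk (B i) (Ψ i) 0 ρ τ ≤ 1/100`: `dΨᵢ(V)` is future-directed on `{t*ᵢ = τ, rᵢ ≤ ρ}`. Sources:
ONeill1983 Ch. 5 p. 145, arXiv:0811.0354 §5.1. -/
theorem stub_orientationSpreadsToSlabs : open scoped Manifold in ∀ (X : Type) [TopologicalSpace X] [ChartedSpace (EuclideanSpace ℝ (Fin 3)) X] [IsManifold (𝓡 3) ((⊤ : ℕ∞) : WithTop ℕ∞) X] [T2Space X] [SecondCountableTopology X] [ConnectedSpace X], ∀ D ∈ Literature.Geometry.Lorentzian.admissibleVacuumData X, ∀ 𝒟 : Literature.Geometry.Lorentzian.VacuumCauchyDevelopment D, 𝒟.IsMaximal → Summit.FinalStateConjecture.HasCompleteNullInfinity 𝒟.toCauchyDevelopment → ∀ (N : ℕ) (M a : Fin N → ℝ) (T δ V C₁ C₂ ρ₀ κ : ℝ) (ξ : Fin N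 → ℝ → EuclideanSpace ℝ (Fin 3)) (β : ℝ → ℝ) (U₀ : TopologicalSpace.Opens Literature.Geometry.Lorentzian.E4) (B₀ : Literature.Geometry.Lorentzian.ModelBackground) (B : Fin N → Literature.Geometry.Lorentzian.ModelBackground) (Ψ₀ : B₀.domain → 𝒟.carrier) (Ψ : (i : Fin N) → (B i).domain → 𝒟.carrier) (O : Set 𝒟.carrier), 𝒟.toCauchyDevelopment.IsFinalEra₂ N M a T δ V C₁ C₂ ρ₀ κ ξ β U₀ B₀ B Ψ₀ Ψ O → (∀ i (τ : ℝ), T < τ → ∀ x ∈ (B i).truncTimeSlab (2 * ρ₀) τ, 𝒟.toSpacetime.timeOrientation.IsFutureDirected (mfderiv 𝓘(ℝ, Literature.Geometry.Lorentzian.E4) (𝓡 4) (Ψ i) x (Literature.Geometry.Lorentzian.Kerr.timeVector (M i) (a i) x.1))) → ∀ i (ρ τ : ℝ), T < τ → 𝒟.toSpacetime.truncDeviationCk (B i) (Ψ i) 0 ρ τ ≤ ENNReal.ofReal (1 / 100) → ∀ x ∈ (B i).truncTimeSlab ρ τ, 𝒟.toSpacetime.timeOrientation.IsFutureDirected (mfderiv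 𝓘(ℝ, Literature.Geometry.Lorentzian.E4) (𝓡 4) (Ψ i) x (Literature.Geometry.Lorentzian.Kerr.timeVector (M i) (a i) x.1)) :=
  Summit.FinalStateConjecture.FinalStateConjecture.Theorems.DissipativeFinalMotions.FinalEraGeneric.stub_orientationSpreadsToSlabs

/-! ## Composition: the crux BY NAME from S2a, S2b₁, S2b₂ (real proof, no `sorry`) -/

section Composition

variable {X : Type} [TopologicalSpace X] [ChartedSpace E3 X] [IsManifold (𝓡 3) ∞ X] [T2Space X]
  [SecondCountableTopology X] [ConnectedSpace X]

/-- The oriented honest era property — complete `𝓘⁺`, rev-2 package, (R) and (F) in every MGHD — for one datum (local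
abbreviation of the composition; the stub signatures spell it out). -/
def EraRF (D : InitialDataSet (𝓡 3) X) : Prop :=
  ∀ 𝒟 : VacuumCauchyDevelopment D, 𝒟.IsMaximal → HasCompleteNullInfinity 𝒟.toCauchyDevelopment ∧
    ∃ (N : ℕ) (M a : Fin N → ℝ) (T δ V C₁ C₂ ρ₀ κ : ℝ) (ξ : Fin N → ℝ → EuclideanSpace ℝ (Fin 3)) (β : ℝ → ℝ)
      (U₀ : TopologicalSpace.Opens E4) (B₀ : ModelBackground) (B : Fin N → ModelBackground) (Ψ₀ : B₀.domain → 𝒟.carrier)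
      (Ψ : (i : Fin N) → (B i).domain → 𝒟.carrier) (O : Set 𝒟.carrier),
      𝒟.toCauchyDevelopment.IsFinalEra₂ N M a T δ V C₁ C₂ ρ₀ κ ξ β U₀ B₀ B Ψ₀ Ψ O ∧
        RaysStayInClosure 𝒟.toCauchyDevelopment O ∧
          ∀ i (ρ : ℝ), ∀ᶠ τ in atTop, ∀ x ∈ (B i).truncTimeSlab ρ τ,
            𝒟.toSpacetime.timeOrientation.IsFutureDirected
              (mfderiv 𝓘(ℝ, E4) (𝓡 4) (Ψ i) x (Kerr.timeVector (M i) (a i) x.1))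

/-- MGHD existence and the oriented honest era property (the crux's property minus (F₀)). -/
def EraM (D : InitialDataSet (𝓡 3) X) : Prop :=
  (∃ 𝒟 : VacuumCauchyDevelopment D, 𝒟.IsMaximal) ∧ EraRF D

/-- Censorship in MGHD form for one datum (S2a's property): an MGHD exists and every MGHD has complete `𝓘⁺`. -/
def CensoredM (D : InitialDataSet (𝓡 3) X) : Prop :=
  (∃ 𝒟 : VacuumCauchyDevelopment D, 𝒟.IsMaximal) ∧
    ∀ 𝒟 : VacuumCauchyDevelopment D, 𝒟.IsMaximal → HasCompleteNullInfinity 𝒟.toCauchyDevelopment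

/-- **The door, by cases on censorship.** If censorship (with MGHD existence) is tame-generic (S2a), eras are generic at censored
exceptional data (S2b₁) and exist near naked data along escaping curves (S2b₂), then `EraM` is tame-generic: through an
`EraM`-exceptional admissible `d`, pass S2b₁'s curve if `d` is censored with an MGHD, and otherwise S2b₂'s curve along the escaping
curve that S2a provides (whose members off `0` are censored with MGHDs because they are not exceptional for S2a's property). This is
`isTameChristodoulouGeneric_of_relative'` (TameGenericityDiagonal) with the base datum's exceptionality kept. -/
theorem eraM_generic (h₂ : Sig.stub_tameCensorship) (h₃ : Sig.stub_eraAtCensoredData) (h₄ : Sig.stub_eraNearNakedData) :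
    InitialDataSet.IsTameChristodoulouGeneric (admissibleVacuumData X) EraM 1 := by
  -- avoidance is LOCAL in the parameter (`isTameChristodoulouGeneric_of_local`, radial reparametrisation)
  refine InitialDataSet.isTameChristodoulouGeneric_of_local fun d hd hdP ↦ ?_
  by_cases hQ : CensoredM d
  · -- censored base with an MGHD: S2b₁
    obtain ⟨e, F', hF', h0, hinj, himm, h𝓓, ε, hε, hP⟩ := h₃ X d hd hQ.1 hQ.2 fun h ↦ hdP ⟨hQ.1, h⟩
    exact ⟨e, F', hF', himm, h0, hinj, h𝓓, ε, hε, hP⟩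
  · -- naked base (or no MGHD): the escaping curve of S2a, then S2b₂
    obtain ⟨e, F, hF, himm, h0, hinj, h𝓓F, hE⟩ := h₂ X d ⟨hd, hQ⟩
    have hcens : ∀ c ≠ 0, CensoredM (F c) := fun c hc ↦ by
      by_contra hc'
      exact hE c hc ⟨h𝓓F c, hc'⟩
    subst h0
    obtain ⟨e', F', hF', h0', hinj', himm', h𝓓', ε, hε, hP'⟩ := h₄ X e F hF himm hinj h𝓓F hcens hQ
    exact ⟨e', F', hF', himm', h0', hinj', h𝓓', ε, hε, hP'⟩

end Composition

/-- **FinalEraGeneric from S2a, S2b₁, S2b₂ and the landed (F₀).** `EraM` is tame-generic by the door (`eraM_generic`); tame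
genericity is monotone under pointwise implication on `𝓓` (`IsTameChristodoulouGeneric.mono`), and pointwise (F₀) is
`flatOrientation_of_isFinalEra₂`. MGHD existence enters only generically (inside S2a and the conclusions of S2b₁, S2b₂): the crux
does not hinge on the pointwise named fact of Choquet-Bruhat–Geroch (rev 1–2's S1 is retired from the skeleton). -/
theorem FinalEraGeneric_of :
    Sig.stub_tameCensorship → Sig.stub_eraAtCensoredData → Sig.stub_eraNearNakedData → FinalEraGeneric := by
  intro h₂ h₃ h₄ X _ _ _ _ _ _
  refine InitialDataSet.IsTameChristodoulouGeneric.mono (eraM_generic h₂ h₃ h₄) fun D _ hP ↦ ⟨hP.1, fun 𝒟 hmax ↦ ?_⟩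
  obtain ⟨hscri, N, M, a, T, δ, V, C₁, C₂, ρ₀, κ, ξ, β, U₀, B₀, B, Ψ₀, Ψ, O, hera, hR, hF⟩ := hP.2 𝒟 hmax
  exact ⟨hscri, N, M, a, T, δ, V, C₁, C₂, ρ₀, κ, ξ, β, U₀, B₀, B, Ψ₀, Ψ, O, hera, hR, hF,
    flatOrientation_of_isFinalEra₂ hera⟩

/-! ## Losslessness: the crux implies each stub (kernel-checked necessity), hence an unconditional equivalence -/

/-- **The crux implies S2a** (forget the era: `IsTameChristodoulouGeneric.mono`). -/
theorem censorship_of_finalEraGeneric (h : FinalEraGeneric) : Sig.stub_tameCensorship := by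
  intro X _ _ _ _ _ _
  exact InitialDataSet.IsTameChristodoulouGeneric.mono (h X) fun D _ hP ↦ ⟨hP.1, fun 𝒟 hmax ↦ (hP.2 𝒟 hmax).1⟩

/-- **The crux implies S2b₁**: an admissible datum one of whose MGHDs lacks an oriented honest era is exceptional for the crux's
property, and the crux's own witness curve serves (its members off `0` satisfy the crux's property, a fortiori `EraM`). -/
theorem eraAtCensored_of_finalEraGeneric (h : FinalEraGeneric) : Sig.stub_eraAtCensoredData := by
  intro X _ _ _ _ _ _ d hd _ _ hdP
  obtain ⟨e, F, hF, himm, h0, hinj, h𝓓, hE⟩ := h X d ⟨hd, fun hP ↦ hdP fun 𝒟 hmax ↦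
    let ⟨hscri, N, M, a, T, δ, V, C₁, C₂, ρ₀, κ, ξ, β, U₀, B₀, B, Ψ₀, Ψ, O, hera, hR, hF, _⟩ := hP.2 𝒟 hmax
    ⟨hscri, N, M, a, T, δ, V, C₁, C₂, ρ₀, κ, ξ, β, U₀, B₀, B, Ψ₀, Ψ, O, hera, hR, hF⟩⟩
  refine ⟨e, F, hF, h0, hinj, himm, h𝓓, 1, one_pos, fun c hc _ ↦ ?_⟩
  have hP : _ := Classical.not_not.mp fun hn ↦ hE c hc ⟨h𝓓 c, hn⟩
  refine ⟨hP.1, fun 𝒟 hmax ↦ ?_⟩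
  obtain ⟨hscri, N, M, a, T, δ, V, C₁, C₂, ρ₀, κ, ξ, β, U₀, B₀, B, Ψ₀, Ψ, O, hera, hR, hF, -⟩ := hP.2 𝒟 hmax
  exact ⟨hscri, N, M, a, T, δ, V, C₁, C₂, ρ₀, κ, ξ, β, U₀, B₀, B, Ψ₀, Ψ, O, hera, hR, hF⟩

/-- **The crux implies S2b₂**: a naked admissible datum (or one without MGHD) is exceptional for the crux's property; the crux's
witness curve through it (on whatever end) serves. -/
theorem eraNearNaked_of_finalEraGeneric (h : FinalEraGeneric) : Sig.stub_eraNearNakedData := by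
  intro X _ _ _ _ _ _ e F _ _ _ h𝓓F _ hQ
  obtain ⟨e', F', hF', himm', h0', hinj', h𝓓', hE'⟩ :=
    h X (F 0) ⟨h𝓓F 0, fun hP ↦ hQ ⟨hP.1, fun 𝒟 hmax ↦ (hP.2 𝒟 hmax).1⟩⟩
  refine ⟨e', F', hF', h0', hinj', himm', h𝓓', 1, one_pos, fun c hc _ ↦ ?_⟩
  have hP : _ := Classical.not_not.mp fun hn ↦ hE' c hc ⟨h𝓓' c, hn⟩
  refine ⟨hP.1, fun 𝒟 hmax ↦ ?_⟩
  obtain ⟨hscri, N, M, a, T, δ, V, C₁, C₂, ρ₀, κ, ξ, β, U₀, B₀, B, Ψ₀, Ψ, O, hera, hR, hF, -⟩ := hP.2 𝒟 hmax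
  exact ⟨hscri, N, M, a, T, δ, V, C₁, C₂, ρ₀, κ, ξ, β, U₀, B₀, B, Ψ₀, Ψ, O, hera, hR, hF⟩

/-- **Losslessness of the rev-3 cut (unconditional).** The crux is EQUIVALENT to the conjunction of the shared leaf S2a (tame
weak cosmic censorship in MGHD form, stmt-17269 verbatim) and the two relative stubs S2b₁ (eras generic at censored data) and
S2b₂ (eras near naked data). Nothing is lost and no named fact is needed for the equivalence. -/
theorem finalEraGeneric_iff :
    FinalEraGeneric ↔ Sig.stub_tameCensorship ∧ Sig.stub_eraAtCensoredData ∧ Sig.stub_eraNearNakedData :=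
  ⟨fun h ↦ ⟨censorship_of_finalEraGeneric h, eraAtCensored_of_finalEraGeneric h, eraNearNaked_of_finalEraGeneric h⟩,
    fun h ↦ FinalEraGeneric_of h.1 h.2.1 h.2.2⟩

/-! ## Supplement: effacement (E) versus orientation (F); rev 2 ⇒ rev 3; the budget re-seam (lead c1) -/

/-- **(E) ⇒ (F) pointwise** (S3a + S3′): for an admissible datum, a maximal development with complete `𝓘⁺` and a tuple satisfying
`IsFinalEra₂`, eventual `C⁰` effacement at every radius gives eventual future-orientation of every hole chart on every slab. So a
prover of S2b₁ / S2b₂ may deliver the metric statement (E) that stability theorems produce. -/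
theorem oriented_of_effaced {X : Type} [TopologicalSpace X] [ChartedSpace E3 X] [IsManifold (𝓡 3) ∞ X] [T2Space X]
    [SecondCountableTopology X] [ConnectedSpace X] {D : InitialDataSet (𝓡 3) X} (hD : D ∈ admissibleVacuumData X)
    {𝒟 : VacuumCauchyDevelopment D} (hmax : 𝒟.IsMaximal) (hscri : HasCompleteNullInfinity 𝒟.toCauchyDevelopment)
    {N : ℕ} {M a : Fin N → ℝ} {T δ V C₁ C₂ ρ₀ κ : ℝ} {ξ : Fin N → ℝ → E3} {β : ℝ → ℝ} {U₀ : TopologicalSpace.Opens E4}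
    {B₀ : ModelBackground} {B : Fin N → ModelBackground} {Ψ₀ : B₀.domain → 𝒟.carrier}
    {Ψ : (i : Fin N) → (B i).domain → 𝒟.carrier} {O : Set 𝒟.carrier}
    (hera : 𝒟.toCauchyDevelopment.IsFinalEra₂ N M a T δ V C₁ C₂ ρ₀ κ ξ β U₀ B₀ B Ψ₀ Ψ O)
    (hE : ∀ i (ρ : ℝ), ∀ᶠ τ in atTop, 𝒟.toSpacetime.truncDeviationCk (B i) (Ψ i) 0 ρ τ ≤ ENNReal.ofReal (1 / 100))
    (i : Fin N) (ρ : ℝ) :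
    ∀ᶠ τ in atTop, ∀ x ∈ (B i).truncTimeSlab ρ τ,
      𝒟.toSpacetime.timeOrientation.IsFutureDirected (mfderiv 𝓘(ℝ, E4) (𝓡 4) (Ψ i) x (Kerr.timeVector (M i) (a i) x.1)) := by
  have htube := stub_tubeOrientation X D hD 𝒟 hmax hscri N M a T δ V C₁ C₂ ρ₀ κ ξ β U₀ B₀ B Ψ₀ Ψ O hera
  filter_upwards [eventually_gt_atTop T, hE i ρ] with τ hτ hEτ
  exact stub_orientationSpreadsToSlabs X D hD 𝒟 hmax hscri N M a T δ V C₁ C₂ ρ₀ κ ξ β U₀ B₀ B Ψ₀ Ψ O hera htube i ρ τ hτ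
    hEτ

/-- **Rev 2 ⇒ rev 3**: MGHD existence (rev 2's S1) and the rev-2 generic core S2′ (effaced eras, lead c1) imply both relative
stubs of rev 3 — the reshape only WEAKENS and SPLITS the open core (through an `EraM`-exceptional datum pass S2′'s witness curve;
its members off `0` have MGHDs by S1 and carry effaced eras, oriented by `oriented_of_effaced`). -/
theorem stubs_of_effacedCore (h₁ : Sig.stub_mghdExists) (h₂ : Sig.stub_tameGenericEraEffaced) :
    Sig.stub_eraAtCensoredData ∧ Sig.stub_eraNearNakedData := by
  -- pointwise on `𝓓`: MGHD existence + effaced eras ⇒ `EraM`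
  have key : ∀ (X : Type) [TopologicalSpace X] [ChartedSpace E3 X] [IsManifold (𝓡 3) ∞ X] [T2Space X]
      [SecondCountableTopology X] [ConnectedSpace X],
      InitialDataSet.IsTameChristodoulouGeneric (admissibleVacuumData X) EraM 1 := by
    intro X _ _ _ _ _ _
    refine InitialDataSet.IsTameChristodoulouGeneric.mono (h₂ X) fun D hD hP ↦ ⟨h₁ X D hD, fun 𝒟 hmax ↦ ?_⟩
    obtain ⟨hscri, N, M, a, T, δ, V, C₁, C₂, ρ₀, κ, ξ, β, U₀, B₀, B, Ψ₀, Ψ, O, hera, hR, hE⟩ := hP 𝒟 hmax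
    exact ⟨hscri, N, M, a, T, δ, V, C₁, C₂, ρ₀, κ, ξ, β, U₀, B₀, B, Ψ₀, Ψ, O, hera, hR,
      oriented_of_effaced hD hmax hscri hera hE⟩
  constructor
  · intro X _ _ _ _ _ _ d hd _ _ hdP
    obtain ⟨e, F, hF, himm, h0, hinj, h𝓓, hE⟩ := key X d ⟨hd, fun h ↦ hdP h.2⟩
    exact ⟨e, F, hF, h0, hinj, himm, h𝓓, 1, one_pos, fun c hc _ ↦ Classical.not_not.mp fun hn ↦ hE c hc ⟨h𝓓 c, hn⟩⟩
  · intro X _ _ _ _ _ _ e F _ _ _ h𝓓F _ hQ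
    obtain ⟨e', F', hF', himm', h0', hinj', h𝓓', hE'⟩ :=
      key X (F 0) ⟨h𝓓F 0, fun hP ↦ hQ ⟨hP.1, fun 𝒟 hmax ↦ (hP.2 𝒟 hmax).1⟩⟩
    exact ⟨e', F', hF', h0', hinj', himm', h𝓓', 1, one_pos, fun c hc _ ↦
      Classical.not_not.mp fun hn ↦ hE' c hc ⟨h𝓓' c, hn⟩⟩

/-- **(E) from dispersal, pointwise** (lead c1). For a tuple satisfying `IsFinalEra₂` whose worldlines pairwise disperse in the
flat chart, every hole chart is eventually `C⁰`-pinned within `1/100` at every radius: dispersal isolates hole `i` beyond any `D'`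
from some time on (finitely many other holes), the effacement clause (H3) then gives `C²`-closeness `≤ 1/100` on `{rᵢ ≤ ρ}`
eventually, and `C⁰ ≤ C²`. Dafermos–Luk arXiv:1710.01722, p. 8; DHRT arXiv:2104.08222, §1. -/
theorem effacement_of_dispersal {X : Type} [TopologicalSpace X] [ChartedSpace E3 X] [IsManifold (𝓡 3) ∞ X] [ConnectedSpace X]
    {D : InitialDataSet (𝓡 3) X} {𝒟 : CauchyDevelopment D} {N : ℕ} {M a : Fin N → ℝ} {T δ V C₁ C₂ ρ₀ κ : ℝ}
    {ξ : Fin N → ℝ → E3} {β : ℝ → ℝ} {U₀ : TopologicalSpace.Opens E4} {B₀ : ModelBackground} {B : Fin N → ModelBackground}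
    {Ψ₀ : B₀.domain → 𝒟.carrier} {Ψ : (i : Fin N) → (B i).domain → 𝒟.carrier} {O : Set 𝒟.carrier}
    (h : 𝒟.IsFinalEra₂ N M a T δ V C₁ C₂ ρ₀ κ ξ β U₀ B₀ B Ψ₀ Ψ O)
    (hdisp : ∀ i j, i ≠ j → Tendsto (fun t ↦ ‖ξ i t - ξ j t‖) atTop atTop) (i : Fin N) (ρ : ℝ) :
    ∀ᶠ τ in atTop, 𝒟.toSpacetime.truncDeviationCk (B i) (Ψ i) 0 ρ τ ≤ ENNReal.ofReal (1 / 100) := by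
  obtain ⟨-, -, -, -, -, -, -, -, -, -, -, -, -, -, -, -, -, -, -, -, -, -, h₂₃, -⟩ := h
  obtain ⟨D', hD'⟩ := h₂₃ i ρ (1 / 100) (by norm_num)
  -- isolation of hole `i` beyond `D'`, eventually (finitely many other holes)
  have hiso : ∀ᶠ t in atTop, ∀ j, j ≠ i → D' ≤ ‖ξ i t - ξ j t‖ := by
    refine eventually_all.2 fun j ↦ ?_
    by_cases hj : j = i
    · exact Eventually.of_forall fun t h ↦ absurd hj h
    · exact ((hdisp i j (Ne.symm hj)).eventually_ge_atTop D').mono fun t ht _ ↦ ht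
  obtain ⟨T', hT'⟩ := eventually_atTop.1 hiso
  obtain ⟨T'', hT''⟩ := hD' T' fun t ht j hj ↦ hT' t ht j hj
  filter_upwards [eventually_ge_atTop T''] with τ hτ
  exact (supCkENorm_mono_right _ (Nat.zero_le 2) _).trans (hT'' τ hτ)

/-- **The rev-2 effaced core from the birth core S2 and the budget crux** (lead c1): pointwise, S2's era has a budget
(`RadiativeLyapunovBudget`), hence dispersing worldlines (`DispersalFromBudget_proof`), hence (E) (`effacement_of_dispersal`). -/
theorem effacedCore_of_core_and_budget (h₂ : Sig.stub_tameGenericEraWithRays) (hB : RadiativeLyapunovBudget) :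
    Sig.stub_tameGenericEraEffaced := by
  intro X _ _ _ _ _ _
  refine InitialDataSet.IsTameChristodoulouGeneric.mono (h₂ X) fun D hD hP 𝒟 hmax ↦ ?_
  obtain ⟨hscri, N, M, a, T, δ, V, C₁, C₂, ρ₀, κ, ξ, β, U₀, B₀, B, Ψ₀, Ψ, O, hera, hR⟩ := hP 𝒟 hmax
  refine ⟨hscri, N, M, a, T, δ, V, C₁, C₂, ρ₀, κ, ξ, β, U₀, B₀, B, Ψ₀, Ψ, O, hera, hR, fun i ρ ↦ ?_⟩
  obtain ⟨E, hanti, hbdd, hcoer⟩ := hB X D hD 𝒟 hmax hscri N M a T δ V C₁ C₂ ρ₀ κ ξ β U₀ B₀ B Ψ₀ Ψ O hera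
  have hdisp := Summit.FinalStateConjecture.FinalStateConjecture.Theorems.DispersalFromBudget_proof N T V ξ E
    hera.2.2.2.2.2.2.2.2.2.2.2.2.2.1 hanti hbdd hcoer
  exact effacement_of_dispersal hera hdisp i ρ

/-- **The crux implies the birth core S2** (forget (F), (F₀) and MGHD existence: `IsTameChristodoulouGeneric.mono`). With
`effacedCore_of_core_and_budget`, `stubs_of_effacedCore` and `finalEraGeneric_iff`: modulo rev 2's S1 and the route's budget crux,
FinalEraGeneric, S2, S2′ and S2a ∧ S2b₁ ∧ S2b₂ are all equivalent. -/
theorem core_of_finalEraGeneric (h : FinalEraGeneric) : Sig.stub_tameGenericEraWithRays := by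
  intro X _ _ _ _ _ _
  refine InitialDataSet.IsTameChristodoulouGeneric.mono (h X) fun D _ hP 𝒟 hmax ↦ ?_
  obtain ⟨hscri, N, M, a, T, δ, V, C₁, C₂, ρ₀, κ, ξ, β, U₀, B₀, B, Ψ₀, Ψ, O, hera, hR, -, -⟩ := hP.2 𝒟 hmax
  exact ⟨hscri, N, M, a, T, δ, V, C₁, C₂, ρ₀, κ, ξ, β, U₀, B₀, B, Ψ₀, Ψ, O, hera, hR⟩

/-- **FinalEraGeneric from rev 2's S1, the birth core S2 and the budget crux alone** (lead c1's re-seam remark, re-derived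
through rev 3): `FinalEraGeneric ⇐ MGHD existence ∧ tame-generic (complete 𝓘⁺ + rev-2 era + (R)) ∧ RadiativeLyapunovBudget`. -/
theorem finalEraGeneric_of_core_and_budget (h₁ : Sig.stub_mghdExists) (h₂ : Sig.stub_tameGenericEraWithRays)
    (hB : RadiativeLyapunovBudget) : FinalEraGeneric := by
  obtain ⟨h₃, h₄⟩ := stubs_of_effacedCore h₁ (effacedCore_of_core_and_budget h₂ hB)
  refine FinalEraGeneric_of (fun X _ _ _ _ _ _ ↦ ?_) h₃ h₄
  exact InitialDataSet.IsTameChristodoulouGeneric.mono (h₂ X) fun D hD hP ↦ ⟨h₁ X D hD, fun 𝒟 hmax ↦ (hP 𝒟 hmax).1⟩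


/-! ## The four-way cut (lead c2, Supplement B; REGISTERED by rev 4, lead c3): peeling the rays clause (R) off S2b₁ —
exterior settling versus interior honesty

A second pass through the door splits S2b₁ LOSSLESSLY into an EXTERIOR statement (oriented eras WITHOUT (R) are generic among censored
data) and an INTERIOR statement ((R) can be secured along curves of settled data). (R) `RaysStayInClosure` is a statement about
black-hole interiors (no future-complete null ray from `Σ` hides off `closure O`; cf. the pointwise item `SettledExteriorHoldsRays`,
stmt-FinalStateConjecture-17673, of route RaychaudhuriBlowdown, and the closed refutation route PocketUniverses), the era package one
about the exterior; the two have different literatures and different failure modes. Rev 4 REGISTERS them (`stub_exteriorEraAtCensoredData`,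
`stub_raysAlongSettledCurves` above; the `Sig.` legends below are their statements verbatim) and derives S2b₁ from them. Kernel-checked
(and landed sorry-free, `Theorems/DissipativeFinalMotionsFinalEraGenericFourWayCut.lean`):
`eraAtCensoredData_of_exterior_of_rays : S2b₁ₐ → S2b₁ᵦ → S2b₁`, necessity of both, and the four-way equivalence
`finalEraGeneric_iff₄ : FinalEraGeneric ↔ S2a ∧ S2b₁ₐ ∧ S2b₁ᵦ ∧ S2b₂`. -/

/-- Statement of `stub_exteriorEraAtCensoredData` (S2b₁ₐ, registered by rev 4): EXTERIOR SETTLING IS GENERIC AMONG CENSORED DATA — through every admissible censored datum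
(with an MGHD) one of whose MGHDs lacks an oriented era (rev-2 package + (F), the rays clause (R) NOT asked) passes a tame injective
immersed curve of admissible data (any end) whose small members off `0` have MGHDs all carrying oriented eras (without (R)). -/
def Sig.stub_exteriorEraAtCensoredData : Prop :=
  open scoped Manifold in ∀ (X : Type) [TopologicalSpace X] [ChartedSpace (EuclideanSpace ℝ (Fin 3)) X] [IsManifold (𝓡 3) ((⊤ : ℕ∞) : WithTop ℕ∞) X] [T2Space X] [SecondCountableTopology X] [ConnectedSpace X], ∀ d ∈ Literature.Geometry.Lorentzian.admissibleVacuumData X, (∃ 𝒟 : Literature.Geometry.Lorentzian.VacuumCauchyDevelopment d, 𝒟.IsMaximal) → (∀ 𝒟 : Literature.Geometry.Lorentzian.VacuumCauchyDevelopment d, 𝒟.IsMaximal → Summit.FinalStateConjecture.HasCompleteNullInfinity 𝒟.toCauchyDevelopment) → ¬ (∀ 𝒟 : Literature.Geometry.Lorentzian.VacuumCauchyDevelopment d, 𝒟.IsMaximal → Summit.FinalStateConjecture.HasCompleteNullInfinity 𝒟.toCauchyDevelopment ∧ ∃ (N : ℕ) (M a : Fin N → ℝ) (T δ V C₁ C₂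 ρ₀ κ : ℝ) (ξ : Fin N → ℝ → EuclideanSpace ℝ (Fin 3)) (β : ℝ → ℝ) (U₀ : TopologicalSpace.Opens Literature.Geometry.Lorentzian.E4) (B₀ : Literature.Geometry.Lorentzian.ModelBackground) (B : Fin N → Literature.Geometry.Lorentzian.ModelBackground) (Ψ₀ : B₀.domain → 𝒟.carrier) (Ψ : (i : Fin N) → (B i).domain → 𝒟.carrier) (O : Set 𝒟.carrier), 𝒟.toCauchyDevelopment.IsFinalEra₂ N M a T δ V C₁ C₂ ρ₀ κ ξ β U₀ B₀ B Ψ₀ Ψ O ∧ (∀ i (ρ : ℝ), ∀ᶠ τ in Filter.atTop, ∀ x ∈ (B i).truncTimeSlab ρ τ, 𝒟.toSpacetime.timeOrientation.IsFutureDirected (mfderiv 𝓘(ℝ, Literature.Geometry.Lorentzian.E4) (𝓡 4) (Ψ i) x (Literature.Geometry.Lorentzian.Kerr.timeVector (M i) (a i) x.1)))) → ∃ (e' : Literature.Geometry.Lorentzian.AFEnd X) (F' : EuclideanSpace ℝ (Fin 1) → Literature.Geometry.Lorentzian.InitialDataSet (𝓡 3) X), Literature.Geometry.Lorentzian.InitialDataSet.IsTameDataFamily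 e' 1 F' ∧ F' 0 = d ∧ Function.Injective F' ∧ Literature.Geometry.Lorentzian.InitialDataSet.IsImmersedAtZero 1 F' ∧ (∀ c, F' c ∈ Literature.Geometry.Lorentzian.admissibleVacuumData X) ∧ ∃ ε > (0 : ℝ), ∀ c, c ≠ 0 → ‖c‖ < ε → (∃ 𝒟 : Literature.Geometry.Lorentzian.VacuumCauchyDevelopment (F' c), 𝒟.IsMaximal) ∧ ∀ 𝒟 : Literature.Geometry.Lorentzian.VacuumCauchyDevelopment (F' c), 𝒟.IsMaximal → Summit.FinalStateConjecture.HasCompleteNullInfinity 𝒟.toCauchyDevelopment ∧ ∃ (N : ℕ) (M a : Fin N → ℝ) (T δ V C₁ C₂ ρ₀ κ : ℝ) (ξ : Fin N → ℝ → EuclideanSpace ℝ (Fin 3)) (β : ℝ → ℝ) (U₀ : TopologicalSpace.Opens Literature.Geometry.Lorentzian.E4) (B₀ : Literature.Geometry.Lorentzian.ModelBackground) (B : Fin N → Literature.Geometry.Lorentzian.ModelBackground) (Ψ₀ : B₀.domain → 𝒟.carrier) (Ψ : (i : Fin N) → (B i).domain → 𝒟.carrier) (O : Set 𝒟.carrier),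 𝒟.toCauchyDevelopment.IsFinalEra₂ N M a T δ V C₁ C₂ ρ₀ κ ξ β U₀ B₀ B Ψ₀ Ψ O ∧ (∀ i (ρ : ℝ), ∀ᶠ τ in Filter.atTop, ∀ x ∈ (B i).truncTimeSlab ρ τ, 𝒟.toSpacetime.timeOrientation.IsFutureDirected (mfderiv 𝓘(ℝ, Literature.Geometry.Lorentzian.E4) (𝓡 4) (Ψ i) x (Literature.Geometry.Lorentzian.Kerr.timeVector (M i) (a i) x.1)))

/-- Statement of `stub_raysAlongSettledCurves` (S2b₁ᵦ, registered by rev 4): HONEST RAYS ALONG SETTLED CURVES — given a tame curve `F` of admissible data on an end `e`,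
immersed-injective or constant, all of whose members off `0` have MGHDs carrying oriented eras WITHOUT (R), and whose base `F 0` is
censored with an MGHD but has an MGHD without an oriented HONEST era (with (R)), there is a tame injective immersed curve through `F 0`
(any end) whose small members off `0` have MGHDs carrying oriented honest eras (with (R)). The interior content of the crux: generically
along settled curves no future-complete null ray from `Σ` hides off the closure of the era's exterior `O`. -/
def Sig.stub_raysAlongSettledCurves : Prop :=
  open scoped Manifold in ∀ (X : Type) [TopologicalSpace X] [ChartedSpace (EuclideanSpace ℝ (Fin 3)) X] [IsManifold (𝓡 3) ((⊤ : ℕ∞) : WithTop ℕ∞) X] [T2Space X] [SecondCountableTopology X] [ConnectedSpace X] (e : Literature.Geometry.Lorentzian.AFEnd X) (F : EuclideanSpace ℝ (Fin 1) → Literature.Geometry.Lorentzian.InitialDataSet (𝓡 3) X), Literature.Geometry.Lorentzian.InitialDataSet.IsTameDataFamily e 1 F → ((Literature.Geometry.Lorentzian.InitialDataSet.IsImmersedAtZero 1 F ∧ Function.Injective F) ∨ ∀ c, F c = F 0) → (∀ c, F c ∈ Literature.Geometry.Lorentzian.admissibleVacuumData X) → (∀ c ≠ 0, (∃ 𝒟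 : Literature.Geometry.Lorentzian.VacuumCauchyDevelopment (F c), 𝒟.IsMaximal) ∧ ∀ 𝒟 : Literature.Geometry.Lorentzian.VacuumCauchyDevelopment (F c), 𝒟.IsMaximal → Summit.FinalStateConjecture.HasCompleteNullInfinity 𝒟.toCauchyDevelopment ∧ ∃ (N : ℕ) (M a : Fin N → ℝ) (T δ V C₁ C₂ ρ₀ κ : ℝ) (ξ : Fin N → ℝ → EuclideanSpace ℝ (Fin 3)) (β : ℝ → ℝ) (U₀ : TopologicalSpace.Opens Literature.Geometry.Lorentzian.E4) (B₀ : Literature.Geometry.Lorentzian.ModelBackground) (B : Fin N → Literature.Geometry.Lorentzian.ModelBackground) (Ψ₀ : B₀.domain → 𝒟.carrier) (Ψ : (i : Fin N) → (B i).domain → 𝒟.carrier) (O : Set 𝒟.carrier), 𝒟.toCauchyDevelopment.IsFinalEra₂ N M a T δ V C₁ C₂ ρ₀ κ ξ β U₀ B₀ B Ψ₀ Ψ O ∧ (∀ i (ρ : ℝ), ∀ᶠ τ in Filter.atTop, ∀ x ∈ (B i).truncTimeSlab ρ τ, 𝒟.toSpacetime.timeOrientation.IsFutureDirected (mfderiv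 𝓘(ℝ, Literature.Geometry.Lorentzian.E4) (𝓡 4) (Ψ i) x (Literature.Geometry.Lorentzian.Kerr.timeVector (M i) (a i) x.1)))) → (∃ 𝒟 : Literature.Geometry.Lorentzian.VacuumCauchyDevelopment (F 0), 𝒟.IsMaximal) → (∀ 𝒟 : Literature.Geometry.Lorentzian.VacuumCauchyDevelopment (F 0), 𝒟.IsMaximal → Summit.FinalStateConjecture.HasCompleteNullInfinity 𝒟.toCauchyDevelopment) → ¬ (∀ 𝒟 : Literature.Geometry.Lorentzian.VacuumCauchyDevelopment (F 0), 𝒟.IsMaximal → Summit.FinalStateConjecture.HasCompleteNullInfinity 𝒟.toCauchyDevelopment ∧ ∃ (N : ℕ) (M a : Fin N → ℝ) (T δ V C₁ C₂ ρ₀ κ : ℝ) (ξ : Fin N → ℝ → EuclideanSpace ℝ (Fin 3)) (β : ℝ → ℝ) (U₀ : TopologicalSpace.Opens Literature.Geometry.Lorentzian.E4) (B₀ : Literature.Geometry.Lorentzian.ModelBackground) (B : Fin N → Literature.Geometry.Lorentzian.ModelBackground) (Ψ₀ : B₀.domain → 𝒟.carrier) (Ψ : (i : Fin N) → (B i).domain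 → 𝒟.carrier) (O : Set 𝒟.carrier), 𝒟.toCauchyDevelopment.IsFinalEra₂ N M a T δ V C₁ C₂ ρ₀ κ ξ β U₀ B₀ B Ψ₀ Ψ O ∧ Summit.FinalStateConjecture.RaysStayInClosure 𝒟.toCauchyDevelopment O ∧ (∀ i (ρ : ℝ), ∀ᶠ τ in Filter.atTop, ∀ x ∈ (B i).truncTimeSlab ρ τ, 𝒟.toSpacetime.timeOrientation.IsFutureDirected (mfderiv 𝓘(ℝ, Literature.Geometry.Lorentzian.E4) (𝓡 4) (Ψ i) x (Literature.Geometry.Lorentzian.Kerr.timeVector (M i) (a i) x.1)))) → ∃ (e' : Literature.Geometry.Lorentzian.AFEnd X) (F' : EuclideanSpace ℝ (Fin 1) → Literature.Geometry.Lorentzian.InitialDataSet (𝓡 3) X), Literature.Geometry.Lorentzian.InitialDataSet.IsTameDataFamily e' 1 F' ∧ F' 0 = F 0 ∧ Function.Injective F' ∧ Literature.Geometry.Lorentzian.InitialDataSet.IsImmersedAtZero 1 F' ∧ (∀ c, F' c ∈ Literature.Geometry.Lorentzian.admissibleVacuumData X) ∧ ∃ ε > (0 : ℝ), ∀ c, c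 ≠ 0 → ‖c‖ < ε → (∃ 𝒟 : Literature.Geometry.Lorentzian.VacuumCauchyDevelopment (F' c), 𝒟.IsMaximal) ∧ ∀ 𝒟 : Literature.Geometry.Lorentzian.VacuumCauchyDevelopment (F' c), 𝒟.IsMaximal → Summit.FinalStateConjecture.HasCompleteNullInfinity 𝒟.toCauchyDevelopment ∧ ∃ (N : ℕ) (M a : Fin N → ℝ) (T δ V C₁ C₂ ρ₀ κ : ℝ) (ξ : Fin N → ℝ → EuclideanSpace ℝ (Fin 3)) (β : ℝ → ℝ) (U₀ : TopologicalSpace.Opens Literature.Geometry.Lorentzian.E4) (B₀ : Literature.Geometry.Lorentzian.ModelBackground) (B : Fin N → Literature.Geometry.Lorentzian.ModelBackground) (Ψ₀ : B₀.domain → 𝒟.carrier) (Ψ : (i : Fin N) → (B i).domain → 𝒟.carrier) (O : Set 𝒟.carrier), 𝒟.toCauchyDevelopment.IsFinalEra₂ N M a T δ V C₁ C₂ ρ₀ κ ξ β U₀ B₀ B Ψ₀ Ψ O ∧ Summit.FinalStateConjecture.RaysStayInClosure 𝒟.toCauchyDevelopment O ∧ (∀ i (ρ : ℝ), ∀ᶠ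 τ in Filter.atTop, ∀ x ∈ (B i).truncTimeSlab ρ τ, 𝒟.toSpacetime.timeOrientation.IsFutureDirected (mfderiv 𝓘(ℝ, Literature.Geometry.Lorentzian.E4) (𝓡 4) (Ψ i) x (Literature.Geometry.Lorentzian.Kerr.timeVector (M i) (a i) x.1)))

/-- **S2b₁ from the exterior and interior halves.** Through a censored `EraRF`-exceptional admissible `d`: if `d` already has oriented eras
without (R) in every MGHD, pass the constant curve (tame on the sole strongly asymptotically flat end that admissibility grants,
`isTameDataFamily_const`) to S2b₁ᵦ; otherwise pass S2b₁ₐ's curve, globalised by `exists_tameCurve_of_local`, to S2b₁ᵦ. -/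
theorem eraAtCensoredData_of_exterior_of_rays (ha : Sig.stub_exteriorEraAtCensoredData) (hb : Sig.stub_raysAlongSettledCurves) :
    Sig.stub_eraAtCensoredData := by
  intro X _ _ _ _ _ _ d hd hM hQ hdP
  by_cases hE₀ : ∀ 𝒟 : VacuumCauchyDevelopment d, 𝒟.IsMaximal → HasCompleteNullInfinity 𝒟.toCauchyDevelopment ∧ ∃ (N : ℕ) (M a : Fin N → ℝ) (T δ V C₁ C₂ ρ₀ κ : ℝ) (ξ : Fin N → ℝ → EuclideanSpace ℝ (Fin 3)) (β : ℝ → ℝ) (U₀ : TopologicalSpace.Opens E4) (B₀ : ModelBackground) (B : Fin N → ModelBackground) (Ψ₀ : B₀.domain → 𝒟.carrier) (Ψ : (i : Fin N) → (B i).domain → 𝒟.carrier) (O : Set 𝒟.carrier), 𝒟.toCauchyDevelopment.IsFinalEra₂ N M a T δ V C₁ C₂ ρ₀ κ ξ β U₀ B₀ B Ψ₀ Ψ O ∧ (∀ i (ρ : ℝ), ∀ᶠ τ in atTop, ∀ x ∈ (B i).truncTimeSlab ρ τ, 𝒟.toSpacetime.timeOrientation.IsFutureDirected (mfderiv 𝓘(ℝ,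 E4) (𝓡 4) (Ψ i) x (Kerr.timeVector (M i) (a i) x.1)))
  · -- exterior eras already at `d`: the constant curve
    obtain ⟨e, hsole, Mass, hSAF⟩ := exists_isSoleEnd_of_mem_admissibleVacuumData hd
    exact hb X e (fun _ ↦ d) (InitialDataSet.isTameDataFamily_const hsole 1 hSAF) (Or.inr fun _ ↦ rfl) (fun _ ↦ hd)
      (fun _ _ ↦ ⟨hM, hE₀⟩) hM hQ hdP
  · -- no exterior era at `d`: S2b₁ₐ's curve, globalised, then S2b₁ᵦ
    obtain ⟨e, F, hF, h0, hinj, himm, h𝓓, ε, hε, hP⟩ := ha X d hd hM hQ hE₀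
    obtain ⟨e', F', hF', h0', hinj', himm', h𝓓', hP'⟩ :=
      InitialDataSet.exists_tameCurve_of_local
        (P := fun D : InitialDataSet (𝓡 3) X ↦ (∃ 𝒟 : VacuumCauchyDevelopment D, 𝒟.IsMaximal) ∧
        ∀ 𝒟 : VacuumCauchyDevelopment D, 𝒟.IsMaximal → HasCompleteNullInfinity 𝒟.toCauchyDevelopment ∧ ∃ (N : ℕ) (M a : Fin N → ℝ) (T δ V C₁ C₂ ρ₀ κ : ℝ) (ξ : Fin N → ℝ → EuclideanSpace ℝ (Fin 3)) (β : ℝ → ℝ) (U₀ : TopologicalSpace.Opens E4) (B₀ : ModelBackground) (B : Fin N → ModelBackground) (Ψ₀ : B₀.domain → 𝒟.carrier) (Ψ : (i : Fin N) → (B i).domain → 𝒟.carrier) (O : Set 𝒟.carrier), 𝒟.toCauchyDevelopment.IsFinalEra₂ N M a T δ V C₁ C₂ ρ₀ κ ξ β U₀ B₀ B Ψ₀ Ψ O ∧ (∀ i (ρ : ℝ), ∀ᶠ τ in atTop, ∀ x ∈ (B i).truncTimeSlab ρ τ, 𝒟.toSpacetime.timeOrientation.IsFutureDirected (mfderiv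 𝓘(ℝ, E4) (𝓡 4) (Ψ i) x (Kerr.timeVector (M i) (a i) x.1))))
        hF h0 hinj himm h𝓓 hε hP
    subst h0'
    exact hb X e' F' hF' (Or.inl ⟨himm', hinj'⟩) h𝓓' hP' hM hQ hdP

/-- **The crux implies S2b₁ₐ** (a datum without oriented exterior eras is exceptional for the crux; its witness serves, `ε = 1`). -/
theorem exteriorEraAtCensored_of_finalEraGeneric (h : FinalEraGeneric) : Sig.stub_exteriorEraAtCensoredData := by
  intro X _ _ _ _ _ _ d hd _ _ hdP
  obtain ⟨e, F, hF, himm, h0, hinj, h𝓓, hE⟩ := h X d ⟨hd, fun hP ↦ hdP fun 𝒟 hmax ↦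
    let ⟨hscri, N, M, a, T, δ, V, C₁, C₂, ρ₀, κ, ξ, β, U₀, B₀, B, Ψ₀, Ψ, O, hera, hR, hF, _⟩ := hP.2 𝒟 hmax
    ⟨hscri, N, M, a, T, δ, V, C₁, C₂, ρ₀, κ, ξ, β, U₀, B₀, B, Ψ₀, Ψ, O, hera, hF⟩⟩
  refine ⟨e, F, hF, h0, hinj, himm, h𝓓, 1, one_pos, fun c hc _ ↦ ?_⟩
  have hP : _ := Classical.not_not.mp fun hn ↦ hE c hc ⟨h𝓓 c, hn⟩
  refine ⟨hP.1, fun 𝒟 hmax ↦ ?_⟩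
  obtain ⟨hscri, N, M, a, T, δ, V, C₁, C₂, ρ₀, κ, ξ, β, U₀, B₀, B, Ψ₀, Ψ, O, hera, hR, hF, -⟩ := hP.2 𝒟 hmax
  exact ⟨hscri, N, M, a, T, δ, V, C₁, C₂, ρ₀, κ, ξ, β, U₀, B₀, B, Ψ₀, Ψ, O, hera, hF⟩

/-- **The crux implies S2b₁ᵦ** (the base is `EraRF`-exceptional, hence exceptional for the crux; its witness serves, `ε = 1`). -/
theorem raysAlongSettledCurves_of_finalEraGeneric (h : FinalEraGeneric) : Sig.stub_raysAlongSettledCurves := by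
  intro X _ _ _ _ _ _ e F _ _ h𝓓F _ _ _ hdP
  obtain ⟨e', F', hF', himm', h0', hinj', h𝓓', hE'⟩ := h X (F 0) ⟨h𝓓F 0, fun hP ↦ hdP fun 𝒟 hmax ↦
    let ⟨hscri, N, M, a, T, δ, V, C₁, C₂, ρ₀, κ, ξ, β, U₀, B₀, B, Ψ₀, Ψ, O, hera, hR, hF, _⟩ := hP.2 𝒟 hmax
    ⟨hscri, N, M, a, T, δ, V, C₁, C₂, ρ₀, κ, ξ, β, U₀, B₀, B, Ψ₀, Ψ, O, hera, hR, hF⟩⟩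
  refine ⟨e', F', hF', h0', hinj', himm', h𝓓', 1, one_pos, fun c hc _ ↦ ?_⟩
  have hP : _ := Classical.not_not.mp fun hn ↦ hE' c hc ⟨h𝓓' c, hn⟩
  refine ⟨hP.1, fun 𝒟 hmax ↦ ?_⟩
  obtain ⟨hscri, N, M, a, T, δ, V, C₁, C₂, ρ₀, κ, ξ, β, U₀, B₀, B, Ψ₀, Ψ, O, hera, hR, hF, -⟩ := hP.2 𝒟 hmax
  exact ⟨hscri, N, M, a, T, δ, V, C₁, C₂, ρ₀, κ, ξ, β, U₀, B₀, B, Ψ₀, Ψ, O, hera, hR, hF⟩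

/-- **Four-way lossless cut (unconditional).** `FinalEraGeneric ↔ S2a ∧ S2b₁ₐ ∧ S2b₁ᵦ ∧ S2b₂`: tame weak cosmic censorship, exterior
settling generic among censored data, honest rays along settled curves, eras near naked data. -/
theorem finalEraGeneric_iff₄ :
    FinalEraGeneric ↔ Sig.stub_tameCensorship ∧ Sig.stub_exteriorEraAtCensoredData ∧ Sig.stub_raysAlongSettledCurves ∧
      Sig.stub_eraNearNakedData :=
  ⟨fun h ↦ ⟨censorship_of_finalEraGeneric h, exteriorEraAtCensored_of_finalEraGeneric h, raysAlongSettledCurves_of_finalEraGeneric h,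
      eraNearNaked_of_finalEraGeneric h⟩,
    fun h ↦ FinalEraGeneric_of h.1 (eraAtCensoredData_of_exterior_of_rays h.2.1 h.2.2.1) h.2.2.2⟩

/-! ## Composition BY NAME from the four registered stubs (rev 4) -/

/-- **Rev 3's S2b₁ from the registered rev-4 stubs S2b₁ₐ, S2b₁ᵦ** (real proof: `eraAtCensoredData_of_exterior_of_rays`). -/
theorem eraAtCensoredData_of_stubs : Sig.stub_eraAtCensoredData :=
  eraAtCensoredData_of_exterior_of_rays stub_exteriorEraAtCensoredData stub_raysAlongSettledCurves

/-- **FinalEraGeneric from S2a, S2b₁ₐ, S2b₁ᵦ, S2b₂** (the rev-4 composition: the four-way cut, then `FinalEraGeneric_of`). -/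
theorem FinalEraGeneric_of₄ :
    Sig.stub_tameCensorship → Sig.stub_exteriorEraAtCensoredData → Sig.stub_raysAlongSettledCurves →
      Sig.stub_eraNearNakedData → FinalEraGeneric :=
  fun h₂ ha hb h₄ ↦ FinalEraGeneric_of h₂ (eraAtCensoredData_of_exterior_of_rays ha hb) h₄

/-- The crux by name, closed modulo the four registered stubs. -/
theorem finalEraGeneric_of_stubs : FinalEraGeneric :=
  FinalEraGeneric_of₄ stub_tameCensorship stub_exteriorEraAtCensoredData stub_raysAlongSettledCurves stub_eraNearNakedData

/-- The same through the LANDED composition `finalEraGeneric_of_relativeCut`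
(`Theorems/DissipativeFinalMotionsFinalEraGenericRelativeCut.lean`, p154795), fed by S2a, the derived S2b₁ and S2b₂. -/
theorem finalEraGeneric_of_stubs' : FinalEraGeneric :=
  Summit.FinalStateConjecture.FinalStateConjecture.Theorems.DissipativeFinalMotions.FinalEraGeneric.finalEraGeneric_of_relativeCut
    stub_tameCensorship eraAtCensoredData_of_stubs stub_eraNearNakedData

end Summit.FinalStateConjecture.FinalStateConjecture.Cruxes.FinalEraGeneric.Birth

end
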